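import Literature.NumberTheory.LFunctions.ZeroDensityNearOneProofs
import Literature.NumberTheory.LFunctions.ZetaFirstZeroCertificate
import Literature.NumberTheory.LFunctions.ExplicitZeroFreeRegionInputs
import HarnessLib

/-!
# Ivić's Theorem 11.3 (11.32) as printed: the tools, and the discharge

NOT RH-BEARING (D-0040; bears_on LADDER-RH §4 HELD row `DensityLadder`, stmt-19600): a density
theorem counts zeros off the line, it never empties the strip (Barrier `LindelofBacklund`);
corpus theorems are RH-FREE literature and nothing in this file is worded as progress toward RH.
WHAT THIS IS NOT: any statement about RH; it kernel-checks a 1985 zero-density theorem near `σ = 1`.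

Topic `NumberTheory/LFunctions`, family RH, statement **rh.S12** (zero density), corpus C4
(Guth–Maynard 2024/2026, §13.2 "[J] or [M3]"). Target: the named fact
`Literature.NumberTheory.LFunctions.Ivic1985_theorem11_3` of `ZeroDensityNearOne.lean` — Ivić 1985,
Theorem 11.3, (11.32) AS PRINTED: for `9/10 ≤ σ ≤ 1` and every `M ≥ max_{1≤t≤3T}|ζ(5σ−4+it)|`,
`N(σ, T) ≤ C · M^{7/6} · log^{169/12} T` (`T ≥ T₀`, one absolute `C`).

## The printed proof (Ivić 1985, pp. 279–281) and how it is followed here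

Ivić: zero detection (§11.2) with the line of integration moved to `Re w = α − β`, `α = 5σ − 4`
(`k = 5`); Class-`R₁` zeros have a large dyadic piece of `∑ a(n)n^{−ρ}` ((11.44), (11.46)) and are
counted by the Halász–Montgomery inequality with the kernel `H(it)` moved to `Re w = α`, giving
`R₁ ≪ Y^{2−2σ} log⁶ T` (11.47) once `X^{2σ−1−α} ≫ M(α,3T) log⁵ T` (11.48); Class-`R₂` zeros make
`M_X(α+it)` large ((11.45), (11.49)) and Halász–Montgomery on the Möbius pieces gives
`R₂ ≪ X^{2−2α}Y^{2α−2σ}M² log⁵T` (11.50) once `Y^{2σ−2α} ≫ M³X^{1−α}log⁴T` (11.51); with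
`σ − α = 4η`, `2σ − 1 − α = 3η`, `1 − α = 5η` (`η = 1 − σ`) the choice of `X, Y` gives
`N ≪ Y^{2−2σ} log^{11} T = (C₂M)^{7/6} log^{37/12 + 11} T = (C₂M)^{7/6} log^{169/12} T` (11.52); the range
`σ ≥ 1 − C/log T` is empty by the zero-free region (1.55).

The tree's framework (road A of `ZeroDensityNearOneProofs.lean`: `NearOneDetect.*`,
`NearOneDensity.*`, and `HalaszTuranLH.*`) is Montgomery's zero detection with the RIESZ kernel
`K(w) = 2/(w(w+1)(w+2))` and `1`-spaced representatives per dyadic height block; it is followed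
verbatim, with three adaptations forced by the AS-PRINTED statement (the majorant `M` covers
`1 ≤ t ≤ 3T` only, and `M` enters with the exact exponent `7/6`):
* Part B: the Halász–Montgomery kernel on `Re w = α` with the sup of `ζ` only on `1 ≤ |t| ≤ 3T`
  (`norm_smoothedKernel_le_line'`): the pole window `|t| < 1` is routed into the `|τ|⁻³` slot
  with the crude bound `1/(1−α) + K(1+|t|)`, the tails `|t| > 3T` likewise; Part A is the Halász
  block count with a free `Φ₂/|τ|³` term (`halasz_block_count'`, generalising
  `HalaszTuranLH.halasz_block_count`; the tree file is untouched).
* Part D: Class II is COUNTED (Ivić (11.49)–(11.50)), not emptied as in road A: the Class-II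
  integral inequality is summed over the representatives and the Halász mean-value bound for the
  Möbius blocks is applied at the SHIFTED points `γ_ρ + y` uniformly in `y` (`classTwo_count'`) —
  this replaces Ivić's pointwise maximisation over `|v| ≤ log²T` and his `log⁴T`-separation, which
  the Riesz kernel's `|y|⁻³` decay does not afford. The tree's `∫|K(−η+iy)|dy ≤ 2π/η₀²` costs a
  power of `1/η ≤ R log T` where Ivić pays `log T`; the `1`-separation costs `log² T` where Ivić's
  (11.12) pays `log⁵ T`; the `M`-exponent `7/6` is exact.
* Part F: `M ≥ m₀ > 0` (`exists_norm_zeta_line_ge`: `ζ(α+i) ≠ 0` by the kernel-checked `N(14) = 0`,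
  `riemannZeta_ne_zero_of_im_pos_of_im_le_fourteen`), so additive `O(1)` terms are `O(M)`; the
  corner `1 − σ < 1/(R log T)` is EMPTY by the tree's classical zero-free region
  (`exists_hasClassicalZeroFreeRegion`, `zetaZeroCountRe_eq_zero_of_zeroFree`).

No new definition, no named fact; standard axioms only.

## References

* A. Ivić, *The Riemann Zeta-Function* (Wiley 1985; Dover 2003), §11.2 (11.4)–(11.12) and §11.4
  Theorem 11.3 with its proof, (11.44)–(11.55), pp. 277–281 (held copy
  `book:ivic1985-riemann-zeta-function-theory-riemann-zeta-function`, chunks p0213–p0216 read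
  first-hand). [key `Ivic1985`]
* E. C. Titchmarsh, *The Theory of the Riemann Zeta-Function*, 2nd ed. (1986), §9.28 (Halász's
  lemma). [key `Titchmarsh1986`]
* H. Iwaniec, E. Kowalski, *Analytic Number Theory* (2004), Theorem 9.6 (duality). [key
  `IwaniecKowalski2004`]
* H. L. Montgomery, R. C. Vaughan, *Multiplicative Number Theory I* (2007), Theorem 6.6 (classical
  zero-free region). [key `MontgomeryVaughan2007`]
* H. M. Edwards, *Riemann's Zeta Function* (1974), §6.6 (`N(14) = 0`). [key `Edwards1974`]
-/

noncomputable section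

open Complex Filter Topology Set MeasureTheory Finset
open scoped Real

namespace Literature.NumberTheory.LFunctions

namespace IvicNearOne

open ZeroDetect NearOneDetect HalaszTuranLH

/-! ## Part A. Halász's block count with a free `|τ|⁻³` term and a free height window -/

/-- **Halász–Montgomery count for one block under a kernel bound with a free cubic term**
(generalisation of `HalaszTuranLH.halasz_block_count`: the kernel hypothesis is
`|G_{4M}(τ)| ≤ Φ₂/|τ|³ + Φ₁` for `1 ≤ |τ| ≤ U` with an arbitrary `Φ₂ ≥ 0` in place of `8M`, and the
ordinates lie in an arbitrary window `[U₁, U₁ + U]`). Let `M ≥ 1`, `V > 0`, `Φ₁, Φ₂ ≥ 0`, and let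
`Z` be a finite set of points `ρ = β + iγ` with `σ ≤ β ≤ σ + 1/2`, `U₁ ≤ γ ≤ U₁ + U`, ordinates
pairwise `≥ 1` apart, each with `|∑_{M<n≤2M} b(n) n^{-ρ}| ≥ V`, and suppose the absorption
condition `18 Φ₁ G ≤ V²`, `G = ∑_{M<n≤2M} |b(n)|² n^{-2σ}`. Then `|Z| ≤ (72 M + 252 Φ₂) G / V²`
(row sums `≤ 4M + 14Φ₂ + |Z|Φ₁` by `HalaszTuranLH.rowsum_le`; Abel summation, the weighted duality
inequality `HalaszTuranLH.sum_norm_sq_le_of_smoothedKernel_bound`, Cauchy's inequality, absorption —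
verbatim the tree's proof). [cite: Titchmarsh1986, §9.28] [cite: Ivic1985, §11.4 (11.46)–(11.47)] -/
theorem halasz_block_count' (b : ℕ → ℂ) {M : ℕ} (hM : 1 ≤ M) {σ U U₁ V Φ₁ Φ₂ : ℝ}
    (hV : 0 < V) (hΦ₁ : 0 ≤ Φ₁) (hΦ₂ : 0 ≤ Φ₂) (Z : Finset ℂ)
    (hre : ∀ ρ ∈ Z, σ ≤ ρ.re ∧ ρ.re ≤ σ + 1 / 2) (him : ∀ ρ ∈ Z, U₁ ≤ ρ.im ∧ ρ.im ≤ U₁ + U)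
    (hsep : ∀ ρ ∈ Z, ∀ ρ' ∈ Z, ρ ≠ ρ' → 1 ≤ |ρ.im - ρ'.im|)
    (hker : ∀ τ : ℝ, 1 ≤ |τ| → |τ| ≤ U →
      ‖∑ n ∈ Finset.Icc 1 (4 * M), ((((1 : ℝ) - (n : ℝ) / (4 * M : ℕ)) ^ 2 : ℝ) : ℂ) *
        (n : ℂ) ^ (-((τ : ℂ) * I))‖ ≤ Φ₂ / |τ| ^ 3 + Φ₁)
    (hlarge : ∀ ρ ∈ Z, V ≤ ‖∑ n ∈ Finset.Ioc M (2 * M), b n * (n : ℂ) ^ (-ρ)‖)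
    (habs : 18 * Φ₁ * (∑ n ∈ Finset.Ioc M (2 * M), ‖b n‖ ^ 2 * (n : ℝ) ^ (-2 * σ)) ≤ V ^ 2) :
    (Z.card : ℝ) ≤ (72 * M + 252 * Φ₂) *
      (∑ n ∈ Finset.Ioc M (2 * M), ‖b n‖ ^ 2 * (n : ℝ) ^ (-2 * σ)) / V ^ 2 := by
  classical
  -- notation
  set Gb : ℝ := ∑ n ∈ Finset.Ioc M (2 * M), ‖b n‖ ^ 2 * (n : ℝ) ^ (-2 * σ) with hGb
  have hGb0 : 0 ≤ Gb := Finset.sum_nonneg fun n _ ↦ by positivity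
  have hM0 : (0 : ℝ) < M := by exact_mod_cast hM
  -- the ordinates
  set 𝒯 : Finset ℝ := Z.image Complex.im with h𝒯
  have hinj : Set.InjOn Complex.im Z := by
    intro ρ hρ ρ' hρ' h
    by_contra hne
    have := hsep ρ hρ ρ' hρ' hne
    rw [h, sub_self, abs_zero] at this
    linarith
  have hcardT : 𝒯.card = Z.card := Finset.card_image_of_injOn hinj
  have hsepT : ∀ t ∈ 𝒯, ∀ t' ∈ 𝒯, t ≠ t' → 1 ≤ |t - t'| := by
    intro t ht t' ht' hne
    simp only [h𝒯, Finset.mem_image] at ht ht'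
    obtain ⟨ρ, hρ, rfl⟩ := ht
    obtain ⟨ρ', hρ', rfl⟩ := ht'
    exact hsep ρ hρ ρ' hρ' fun h ↦ hne (by rw [h])
  have hmemT : ∀ t ∈ 𝒯, U₁ ≤ t ∧ t ≤ U₁ + U := by
    intro t ht
    simp only [h𝒯, Finset.mem_image] at ht
    obtain ⟨ρ, hρ, rfl⟩ := ht
    exact him ρ hρ
  -- the row-sum bound `B`
  set B : ℝ := 4 * M + 14 * Φ₂ + Z.card * Φ₁ with hB
  have hB0 : 0 ≤ B := by rw [hB]; positivity
  have hrow : ∀ t ∈ 𝒯, ∑ t' ∈ 𝒯, ‖∑ n ∈ Finset.Icc 1 (4 * M),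
      ((((1 : ℝ) - (n : ℝ) / (4 * M : ℕ)) ^ 2 : ℝ) : ℂ) * (n : ℂ) ^ (-(((t - t' : ℝ) : ℂ) * I))‖ ≤ B := by
    intro t ht
    have h := rowsum_le 𝒯 hsepT (g := fun τ ↦ ‖∑ n ∈ Finset.Icc 1 (4 * M),
      ((((1 : ℝ) - (n : ℝ) / (4 * M : ℕ)) ^ 2 : ℝ) : ℂ) * (n : ℂ) ^ (-((τ : ℂ) * I))‖)
      (D := 4 * M) (Φ₁ := Φ₁) (Φ₂ := Φ₂) hΦ₁ hΦ₂
      (by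
        have := norm_smoothedKernel_le_self (4 * M) 0
        push_cast at this ⊢
        exact this)
      (by
        intro t₁ ht₁ t₂ ht₂ hne
        have h1 : 1 ≤ |t₁ - t₂| := hsepT t₁ ht₁ t₂ ht₂ hne
        have h2 : |t₁ - t₂| ≤ U := by
          obtain ⟨ha1, ha2⟩ := hmemT t₁ ht₁
          obtain ⟨hb1, hb2⟩ := hmemT t₂ ht₂
          rw [abs_le]; constructor <;> linarith
        exact hker (t₁ - t₂) h1 h2) ht
    rw [hcardT] at h
    simpa only [hB] using h
  -- the coefficients `a_u(n) = b(n) n^{-σ}` on `M < n ≤ u`, and the partial sums `S_u(t)`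
  set a : ℕ → ℕ → ℂ := fun u n ↦ if M < n ∧ n ≤ u then b n * (((n : ℝ) ^ (-σ) : ℝ) : ℂ) else 0
    with ha
  set S : ℕ → ℝ → ℂ := fun u t ↦ ∑ n ∈ Finset.Icc 1 (2 * M), a u n * (n : ℂ) ^ (-((t : ℂ) * I)) with hS
  have hS_eq : ∀ u, u ≤ 2 * M → ∀ t : ℝ, S u t =
      ∑ n ∈ Finset.Ioc M u, b n * (((n : ℝ) ^ (-σ) : ℝ) : ℂ) * (n : ℂ) ^ (-((t : ℂ) * I)) := by
    intro u hu t
    simp only [hS, ha]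
    rw [← Finset.sum_filter_add_sum_filter_not (Finset.Icc 1 (2 * M)) (fun n ↦ M < n ∧ n ≤ u)]
    have e : (Finset.Icc 1 (2 * M)).filter (fun n ↦ M < n ∧ n ≤ u) = Finset.Ioc M u := by
      ext n; simp; omega
    rw [e]
    have h0 : ∑ n ∈ (Finset.Icc 1 (2 * M)).filter (fun n ↦ ¬ (M < n ∧ n ≤ u)),
        (if M < n ∧ n ≤ u then b n * (((n : ℝ) ^ (-σ) : ℝ) : ℂ) else 0) * (n : ℂ) ^ (-((t : ℂ) * I)) = 0 :=
      Finset.sum_eq_zero fun n hn ↦ by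
        simp only [Finset.mem_filter] at hn; simp [hn.2]
    rw [h0, add_zero]
    refine Finset.sum_congr rfl fun n hn ↦ ?_
    simp only [Finset.mem_Ioc] at hn
    simp [hn]
  -- Step 1: the weighted duality inequality for each `u`, uniformly
  have hMVT : ∀ u, u ≤ 2 * M → ∑ ρ ∈ Z, ‖S u ρ.im‖ ^ 2 ≤ 4 * B * Gb := by
    intro u hu
    rw [← Finset.sum_image (f := fun t : ℝ ↦ ‖S u t‖ ^ 2) hinj]
    have h1 := sum_norm_sq_le_of_smoothedKernel_bound (2 * M) (4 * M) (by omega) (a u) 𝒯 hB0 hrow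
    have hsuma : ∑ n ∈ Finset.Icc 1 (2 * M), ‖a u n‖ ^ 2 ≤ Gb := by
      calc ∑ n ∈ Finset.Icc 1 (2 * M), ‖a u n‖ ^ 2
          ≤ ∑ n ∈ Finset.Icc 1 (2 * M), (if M < n then ‖b n‖ ^ 2 * (n : ℝ) ^ (-2 * σ) else 0) := by
            refine Finset.sum_le_sum fun n hn ↦ ?_
            simp only [ha]
            by_cases h : M < n ∧ n ≤ u
            · rw [if_pos h, if_pos h.1, norm_mul, mul_pow, Complex.norm_real,
                Real.norm_of_nonneg (Real.rpow_nonneg (Nat.cast_nonneg n) _),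
                ZeroDensity.rpow_neg_sq (Nat.cast_nonneg n)]
            · rw [if_neg h, norm_zero]
              split_ifs
              · simp only [ne_eq, OfNat.ofNat_ne_zero, not_false_eq_true, zero_pow]
                positivity
              · simp
        _ = ∑ n ∈ (Finset.Icc 1 (2 * M)).filter (fun n ↦ M < n), ‖b n‖ ^ 2 * (n : ℝ) ^ (-2 * σ) :=
            (Finset.sum_filter _ _).symm
        _ = Gb := by
            rw [hGb]
            congr 1
            ext n; simp; omega
    calc ∑ x ∈ 𝒯, ‖S u x‖ ^ 2 ≤ 4 * B * ∑ n ∈ Finset.Icc 1 (2 * M), ‖a u n‖ ^ 2 := h1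
      _ ≤ 4 * B * Gb := mul_le_mul_of_nonneg_left hsuma (by positivity)
  -- Step 2: Abel summation for each `ρ`
  have hAbel : ∀ ρ ∈ Z, ‖∑ n ∈ Finset.Ioc M (2 * M), b n * (n : ℂ) ^ (-ρ)‖ ≤
      ‖S (2 * M) ρ.im‖ + ∑ u ∈ Finset.Ioo M (2 * M), ‖S u ρ.im‖ * (1 / (2 * (u : ℝ))) := by
    intro ρ hρ
    set δ : ℝ := ρ.re - σ with hδ
    have hδ0 : 0 ≤ δ := by rw [hδ]; linarith [(hre ρ hρ).1]
    have hδ1 : δ ≤ 1 / 2 := by rw [hδ]; linarith [(hre ρ hρ).2]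
    set c : ℕ → ℂ := fun n ↦ b n * (((n : ℝ) ^ (-σ) : ℝ) : ℂ) * (n : ℂ) ^ (-((ρ.im : ℂ) * I))
      with hc
    set w : ℕ → ℝ := fun n ↦ (n : ℝ) ^ (-δ) with hw
    have hD : ∑ n ∈ Finset.Ioc M (2 * M), b n * (n : ℂ) ^ (-ρ) =
        ∑ n ∈ Finset.Ioc M (2 * M), c n * (w n : ℂ) := by
      refine Finset.sum_congr rfl fun n hn ↦ ?_
      simp only [Finset.mem_Ioc] at hn
      rw [ZeroDensity.natCast_cpow_neg_eq n (by omega) ρ σ, hc, hw, hδ]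
      ring
    have hSc : ∀ u, u ≤ 2 * M → ∑ n ∈ Finset.Ioc M u, c n = S u ρ.im :=
      fun u hu ↦ (hS_eq u hu ρ.im).symm
    rw [hD]
    have hM2 : (1 : ℝ) ≤ ((2 * M : ℕ) : ℝ) := by exact_mod_cast (by omega : 1 ≤ 2 * M)
    have hw1 : w (2 * M) ≤ 1 := Real.rpow_le_one_of_one_le_of_nonpos hM2 (by linarith)
    have hw0 : 0 ≤ w (2 * M) := Real.rpow_nonneg (by positivity) _
    have hmono : ∀ u ∈ Finset.Ioo M (2 * M), w (u + 1) ≤ w u := by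
      intro u hu
      simp only [Finset.mem_Ioo] at hu
      have hu0 : (0 : ℝ) < u := by exact_mod_cast (by omega : 0 < u)
      simp only [hw]
      push_cast
      exact Real.rpow_le_rpow_of_nonpos hu0 (by linarith) (by linarith)
    refine (ZeroDensity.norm_sum_Ioc_mul_le_abel c w M (by omega) hw1 hw0 hmono).trans ?_
    rw [hSc (2 * M) le_rfl]
    refine add_le_add le_rfl (Finset.sum_le_sum fun u hu ↦ ?_)
    simp only [Finset.mem_Ioo] at hu
    rw [hSc u (by omega)]
    refine mul_le_mul_of_nonneg_left ?_ (norm_nonneg _)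
    have hu1 : (1 : ℝ) ≤ u := by exact_mod_cast (by omega : 1 ≤ u)
    have := ZeroDensity.rpow_neg_sub_rpow_neg_succ_le hδ0 hδ1 hu1
    simp only [hw]
    push_cast
    exact this
  -- Step 3: sum over `Z`, Cauchy–Schwarz, and the uniform bound of Step 1
  set Q : ℝ := Real.sqrt (Z.card * (4 * B * Gb)) with hQ
  have hQ0 : 0 ≤ Q := Real.sqrt_nonneg _
  have hCS : ∀ u, u ≤ 2 * M → ∑ ρ ∈ Z, ‖S u ρ.im‖ ≤ Q := by
    intro u hu
    have h1 := sq_sum_le_card_mul_sum_sq (s := Z) (f := fun ρ ↦ ‖S u ρ.im‖)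
    have h2 : (∑ ρ ∈ Z, ‖S u ρ.im‖) ^ 2 ≤ Z.card * (4 * B * Gb) :=
      h1.trans (mul_le_mul_of_nonneg_left (hMVT u hu) (Nat.cast_nonneg _))
    rw [hQ]
    exact (Real.le_sqrt (Finset.sum_nonneg fun _ _ ↦ norm_nonneg _) (by positivity)).2 h2
  have hsum_inv : ∑ u ∈ Finset.Ioo M (2 * M), (1 / (2 * (u : ℝ))) ≤ 1 / 2 := by
    have h1 : ∀ u ∈ Finset.Ioo M (2 * M), (1 / (2 * (u : ℝ))) ≤ 1 / (2 * ((M : ℝ) + 1)) := by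
      intro u hu
      simp only [Finset.mem_Ioo] at hu
      have : (M : ℝ) + 1 ≤ u := by exact_mod_cast (by omega : M + 1 ≤ u)
      exact one_div_le_one_div_of_le (by positivity) (by linarith)
    refine (Finset.sum_le_sum h1).trans ?_
    rw [Finset.sum_const, nsmul_eq_mul, Nat.card_Ioo]
    have hM' : ((2 * M - M - 1 : ℕ) : ℝ) ≤ (M : ℝ) + 1 := by
      have : 2 * M - M - 1 ≤ M + 1 := by omega
      exact_mod_cast this
    have hM1 : (0 : ℝ) < (M : ℝ) + 1 := by positivity
    calc ((2 * M - M - 1 : ℕ) : ℝ) * (1 / (2 * ((M : ℝ) + 1)))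
        ≤ ((M : ℝ) + 1) * (1 / (2 * ((M : ℝ) + 1))) :=
          mul_le_mul_of_nonneg_right hM' (by positivity)
      _ = 1 / 2 := by field_simp
  have hmain : V * Z.card ≤ 3 / 2 * Q := by
    calc V * Z.card = ∑ ρ ∈ Z, V := by rw [Finset.sum_const, nsmul_eq_mul, mul_comm]
      _ ≤ ∑ ρ ∈ Z, ‖∑ n ∈ Finset.Ioc M (2 * M), b n * (n : ℂ) ^ (-ρ)‖ := Finset.sum_le_sum hlarge
      _ ≤ ∑ ρ ∈ Z, (‖S (2 * M) ρ.im‖ + ∑ u ∈ Finset.Ioo M (2 * M), ‖S u ρ.im‖ * (1 / (2 * (u : ℝ)))) :=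
          Finset.sum_le_sum hAbel
      _ = ∑ ρ ∈ Z, ‖S (2 * M) ρ.im‖ +
            ∑ u ∈ Finset.Ioo M (2 * M), (1 / (2 * (u : ℝ))) * ∑ ρ ∈ Z, ‖S u ρ.im‖ := by
          rw [Finset.sum_add_distrib, Finset.sum_comm]
          congr 1
          refine Finset.sum_congr rfl fun u _ ↦ ?_
          rw [Finset.mul_sum]
          refine Finset.sum_congr rfl fun ρ _ ↦ by ring
      _ ≤ Q + ∑ u ∈ Finset.Ioo M (2 * M), (1 / (2 * (u : ℝ))) * Q := by
          refine add_le_add (hCS (2 * M) le_rfl) (Finset.sum_le_sum fun u hu ↦ ?_)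
          simp only [Finset.mem_Ioo] at hu
          exact mul_le_mul_of_nonneg_left (hCS u (by omega)) (by positivity)
      _ = Q * (1 + ∑ u ∈ Finset.Ioo M (2 * M), (1 / (2 * (u : ℝ)))) := by
          rw [← Finset.sum_mul]; ring
      _ ≤ Q * (1 + 1 / 2) := mul_le_mul_of_nonneg_left (by linarith) hQ0
      _ = 3 / 2 * Q := by ring
  -- Step 4: `V² |Z| ≤ 9 B G`, and absorb `|Z| Φ₁`
  have hsq : (V * Z.card) ^ 2 ≤ 9 / 4 * (Z.card * (4 * B * Gb)) := by
    have h := pow_le_pow_left₀ (by positivity) hmain 2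
    have e : (3 / 2 * Q) ^ 2 = 9 / 4 * (Z.card * (4 * B * Gb)) := by
      rw [mul_pow, hQ, Real.sq_sqrt (by positivity)]; ring
    linarith
  rcases Nat.eq_zero_or_pos Z.card with hZ | hZ
  · rw [hZ]; simp only [Nat.cast_zero]; positivity
  · have hZ' : (0 : ℝ) < Z.card := by exact_mod_cast hZ
    have h1 : V ^ 2 * Z.card ≤ 9 * B * Gb := by
      have : (V ^ 2 * Z.card) * Z.card ≤ (9 * B * Gb) * Z.card := by nlinarith
      exact le_of_mul_le_mul_right this hZ'
    have h2 : V ^ 2 * Z.card ≤ (36 * M + 126 * Φ₂) * Gb + Z.card * (V ^ 2 / 2) := by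
      have e : 9 * B * Gb = (36 * M + 126 * Φ₂) * Gb + Z.card * (9 * Φ₁ * Gb) := by rw [hB]; ring
      rw [e] at h1
      have h3 : Z.card * (9 * Φ₁ * Gb) ≤ Z.card * (V ^ 2 / 2) :=
        mul_le_mul_of_nonneg_left (by nlinarith) hZ'.le
      linarith
    rw [le_div_iff₀ (by positivity)]
    nlinarith

/-! ## Part B. The smoothed kernel at the line `α` with the sup of `ζ` only on `1 ≤ |t| ≤ 3T` -/

/-- `‖K(α + iv)‖ ≤ 4/(1/4 + v²)` for `α ≥ 1/2` (distance `≥ 1/2` from the poles `0, −1, −2`;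
the private lemma of `ZeroDensityNearOneDetection.lean`, re-derived). [folklore] -/
private theorem norm_rieszK_line_le {α : ℝ} (hα : 1 / 2 ≤ α) (v : ℝ) :
    ‖rieszK ((α : ℂ) + v * I)‖ ≤ 4 * ((1 / 2 : ℝ) ^ 2 + v ^ 2)⁻¹ := by
  have h := Literature.NumberTheory.LFunctions.RieszPerron.norm_Kfun_le (σ := α) (m := 1 / 2)
    (by norm_num) (by rw [abs_of_pos (by linarith)]; exact hα)
    (by rw [abs_of_pos (by linarith)]; linarith) (by rw [abs_of_pos (by linarith)]; linarith) v
  calc ‖rieszK ((α : ℂ) + v * I)‖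
      = ‖((1 : ℂ) / (α + v * I) - 2 / ((α + v * I) + 1) + 1 / ((α + v * I) + 2))‖ := rfl
    _ ≤ 2 / (1 / 2 * ((1 / 2 : ℝ) ^ 2 + v ^ 2)) := h
    _ = 4 * ((1 / 2 : ℝ) ^ 2 + v ^ 2)⁻¹ := by
        have : (0 : ℝ) < (1 / 2 : ℝ) ^ 2 + v ^ 2 := by positivity
        field_simp
        ring

/-- `‖K(α + iv)‖ ≤ 16` for `α ≥ 1/2`. [folklore] -/
private theorem norm_rieszK_line_le_sixteen {α : ℝ} (hα : 1 / 2 ≤ α) (v : ℝ) :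
    ‖rieszK ((α : ℂ) + v * I)‖ ≤ 16 := by
  refine (norm_rieszK_line_le hα v).trans ?_
  have h1 : (1 / 2 : ℝ) ^ 2 ≤ (1 / 2 : ℝ) ^ 2 + v ^ 2 := by nlinarith
  have h2 : ((1 / 2 : ℝ) ^ 2 + v ^ 2)⁻¹ ≤ ((1 / 2 : ℝ) ^ 2)⁻¹ := inv_anti₀ (by norm_num) h1
  calc 4 * ((1 / 2 : ℝ) ^ 2 + v ^ 2)⁻¹ ≤ 4 * ((1 / 2 : ℝ) ^ 2)⁻¹ := by gcongr
    _ = 16 := by norm_num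

/-- `v ↦ ‖K(α + iv)‖` is integrable on `ℝ` (`α ≥ 1/2`). [folklore] -/
private theorem integrable_norm_rieszK_line {α : ℝ} (hα : 1 / 2 ≤ α) :
    Integrable fun v : ℝ ↦ ‖rieszK ((α : ℂ) + v * I)‖ := by
  have h := (Literature.NumberTheory.LFunctions.RieszPerron.integrable_Kfun_line (σ := α)
    (m := 1 / 2) (by norm_num) (by rw [abs_of_pos (by linarith)]; exact hα)
    (by rw [abs_of_pos (by linarith)]; linarith) (by rw [abs_of_pos (by linarith)]; linarith)).norm
  exact h

/-- `∫_ℝ ‖K(α + iv)‖ dv ≤ 8π` (`α ≥ 1/2`). [folklore] -/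
private theorem integral_norm_rieszK_line_le {α : ℝ} (hα : 1 / 2 ≤ α) :
    ∫ v : ℝ, ‖rieszK ((α : ℂ) + v * I)‖ ≤ 8 * π := by
  have hg : Integrable fun v : ℝ ↦ 4 * ((1 / 2 : ℝ) ^ 2 + v ^ 2)⁻¹ :=
    (Literature.NumberTheory.LFunctions.RieszPerron.integrable_inv_sq_add_sq
      (m := 1 / 2) (by norm_num)).const_mul 4
  calc ∫ v : ℝ, ‖rieszK ((α : ℂ) + v * I)‖
      ≤ ∫ v : ℝ, 4 * ((1 / 2 : ℝ) ^ 2 + v ^ 2)⁻¹ :=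
        integral_mono (integrable_norm_rieszK_line hα) hg (norm_rieszK_line_le hα)
    _ = 4 * (π / (1 / 2)) := by
        rw [MeasureTheory.integral_const_mul, ZeroDensity.integral_inv_sq_add_sq_real (by norm_num)]
    _ = 8 * π := by ring

/-- **The smoothed kernel under a bound for `ζ` on `1 ≤ |t| ≤ 3T` of the line `Re s = α`** (the
term `M^{1+α−2σ} M(α, 3T)` of Ivić (11.46), with Ivić's `M(α, 3T) = max_{1≤t≤3T}|ζ(α+it)|` — the
pole window `|t| < 1` is NOT covered by the sup; `NearOneDetect.norm_smoothedKernel_le_line` takes the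
sup over `|t| ≤ 3U` instead). If `1/2 ≤ α < 1`, `|ζ(α+it)| ≤ M` for `1 ≤ |t| ≤ 3T`, and the crude
bound `|ζ(α+it)| ≤ 1/(1−α) + K(1+|t|)` holds, then for `Y ≥ 1`, `1 ≤ |τ| ≤ 2T`,
`‖∑_{n ≤ Y} (1 − n/Y)² n^{−iτ}‖ ≤ (2Y + Y^α (128/(1−α) + 256K)/π)/|τ|³ + Y^α (4M + (2/(1−α) + 8K)/T)`:
in the line integral `(1/2π)∫ Y^{α+iv}K(α+iv)ζ(α+i(τ+v))dv` of
`NearOneDetect.smoothedKernel_identity_line`, the window `|τ + v| ≤ 1` has length `2`, kernel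
`≤ 128/|τ|³` and `|ζ| ≤ 1/(1−α) + 2K`; on `1 < |τ+v| ≤ 3T` the sup `M` and `∫|K| ≤ 8π`; on
`|τ+v| > 3T` one has `|v| > T` and the crude bound against `2/|v|³`. This is the hypothesis `hker` of
`halasz_block_count'` with `Φ₂ = 2Y + Y^α(128/(1−α)+256K)/π`. [cite: Ivic1985, §11.4 (11.46)–(11.48)] -/
theorem norm_smoothedKernel_le_line' {Y : ℕ} (hY : 1 ≤ Y) {α T M K : ℝ} (hα : 1 / 2 ≤ α)
    (hα1 : α < 1) (hT : 1 ≤ T) (hM0 : 0 ≤ M) (hK0 : 0 ≤ K)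
    (hM : ∀ t : ℝ, 1 ≤ |t| → |t| ≤ 3 * T → ‖riemannZeta ((α : ℂ) + t * I)‖ ≤ M)
    (hK : ∀ t : ℝ, ‖riemannZeta ((α : ℂ) + t * I)‖ ≤ 1 / (1 - α) + K * (1 + |t|))
    {τ : ℝ} (hτ1 : 1 ≤ |τ|) (hτU : |τ| ≤ 2 * T) :
    ‖∑ n ∈ Finset.Icc 1 Y, ((((1 : ℝ) - (n : ℝ) / Y) ^ 2 : ℝ) : ℂ) * (n : ℂ) ^ (-((τ : ℂ) * I))‖ ≤
      (2 * Y + (Y : ℝ) ^ α * ((128 / (1 - α) + 256 * K) / π)) / |τ| ^ 3 +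
        (Y : ℝ) ^ α * (4 * M + (2 / (1 - α) + 8 * K) / T) := by
  obtain ⟨-, hid⟩ := smoothedKernel_identity_line hY hα hα1 hτ1
  rw [hid]
  have hY0 : 0 < Y := hY
  have hY0r : (0 : ℝ) < Y := by exact_mod_cast hY0
  have hT0 : 0 < T := by linarith
  have h1α : 0 < 1 - α := by linarith
  have hτ0 : τ ≠ 0 := fun h ↦ by rw [h, abs_zero] at hτ1; linarith
  have hτpos : 0 < |τ| := abs_pos.2 hτ0
  have hτ3 : 0 < |τ| ^ 3 := by positivity
  -- the residue term
  have hres : ‖(Y : ℂ) ^ (1 - (τ : ℂ) * I) * rieszK (1 - (τ : ℂ) * I)‖ ≤ 2 * Y / |τ| ^ 3 := by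
    rw [norm_mul]
    have h1 : ‖(Y : ℂ) ^ (1 - (τ : ℂ) * I)‖ = Y := by
      rw [Complex.norm_natCast_cpow_of_pos hY0]; simp
    have h2 : ‖rieszK (1 - (τ : ℂ) * I)‖ ≤ 2 / |τ| ^ 3 := by
      have h := ZeroDensity.norm_rieszK_le_two_div_cube 1 (y := -τ) (neg_ne_zero.2 hτ0)
      rw [abs_neg] at h
      have e : (((1 : ℝ) : ℂ) + ((-τ : ℝ) : ℂ) * I) = 1 - (τ : ℂ) * I := by push_cast; ring
      rwa [e] at h
    rw [h1]
    calc (Y : ℝ) * ‖rieszK (1 - (τ : ℂ) * I)‖ ≤ Y * (2 / |τ| ^ 3) := by gcongr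
      _ = 2 * Y / |τ| ^ 3 := by ring
  -- the line integral
  set g : ℝ → ℂ := fun v ↦ (Y : ℂ) ^ ((α : ℂ) + v * I) *
    rieszK ((α : ℂ) + v * I) * riemannZeta (α + ((τ : ℂ) + v) * I) with hg
  set fK : ℝ → ℝ := fun v ↦ ‖rieszK ((α : ℂ) + v * I)‖ with hfK
  set f : ℝ → ℝ := fun v ↦ fK v * ‖riemannZeta (α + ((τ : ℂ) + v) * I)‖ with hf
  have hf0 : ∀ v, 0 ≤ f v := fun v ↦ by positivity
  have hnorm_g : ∀ v, ‖g v‖ = (Y : ℝ) ^ α * f v := by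
    intro v
    simp only [hg, hf, hfK, norm_mul]
    rw [Complex.norm_natCast_cpow_of_pos hY0]
    simp
    ring
  have hfKint : Integrable fK := integrable_norm_rieszK_line hα
  have hζarg : ∀ v : ℝ, (α : ℂ) + ((τ : ℂ) + v) * I = (α : ℂ) + ((τ + v : ℝ) : ℂ) * I := by
    intro v; push_cast; ring
  -- the three pieces of `∫ f`
  set cP : ℝ := (256 / (1 - α) + 512 * K) / |τ| ^ 3 with hcP
  set cF : ℝ := (4 / (1 - α) + 16 * K) / T with hcF
  have hcP0 : 0 ≤ cP := by positivity
  have hcF0 : 0 ≤ cF := by positivity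
  have hfint : ∫ v, f v ≤ cP + 8 * π * M + π * cF := by
    by_cases hfi : Integrable f
    · -- `s₁`: the pole window `|τ + v| ≤ 1`
      set s₁ : Set ℝ := Set.Icc (-τ - 1) (-τ + 1) with hs₁
      have hs₁m : MeasurableSet s₁ := measurableSet_Icc
      have hmem₁ : ∀ v, v ∈ s₁ ↔ |τ + v| ≤ 1 := by
        intro v; rw [hs₁, Set.mem_Icc, abs_le]; constructor <;> intro h <;> constructor <;> linarith
      -- `s₂`: `|τ + v| ≤ 3T`
      set s₂ : Set ℝ := Set.Icc (-τ - 3 * T) (-τ + 3 * T) with hs₂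
      have hs₂m : MeasurableSet s₂ := measurableSet_Icc
      have hmem₂ : ∀ v, v ∈ s₂ ↔ |τ + v| ≤ 3 * T := by
        intro v; rw [hs₂, Set.mem_Icc, abs_le]; constructor <;> intro h <;> constructor <;> linarith
      have hsplit₁ : ∫ v, f v = (∫ v in s₁, f v) + ∫ v in s₁ᶜ, f v :=
        (integral_add_compl hs₁m hfi).symm
      have hsplit₂ : ∫ v in s₁ᶜ, f v = (∫ v in s₁ᶜ ∩ s₂, f v) + ∫ v in s₁ᶜ \ s₂, f v :=
        (integral_inter_add_sdiff hs₂m hfi.integrableOn).symm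
      -- the kernel on the pole window: `fK v ≤ 128/|τ|³`
      have hKP : ∀ v ∈ s₁, fK v ≤ 128 / |τ| ^ 3 := by
        intro v hv
        rw [hmem₁] at hv
        rcases le_or_gt 2 |τ| with hτ2 | hτ2
        · -- `|v| ≥ |τ| − 1 ≥ |τ|/2`
          have hv1 : |τ| - 1 ≤ |v| := by
            have := abs_add_le (τ + v) (-v)
            rw [show τ + v + -v = τ by ring, abs_neg] at this
            linarith
          have hv2 : |τ| / 2 ≤ |v| := by linarith
          have hv0 : v ≠ 0 := fun h ↦ by rw [h, abs_zero] at hv2; linarith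
          have hvp : 0 < |v| := abs_pos.2 hv0
          calc fK v ≤ 2 / |v| ^ 3 := ZeroDensity.norm_rieszK_le_two_div_cube α hv0
            _ ≤ 2 / (|τ| / 2) ^ 3 := by
                gcongr
            _ = 16 / |τ| ^ 3 := by field_simp; ring
            _ ≤ 128 / |τ| ^ 3 := by gcongr; norm_num
        · have h8 : |τ| ^ 3 ≤ 8 := by
            have := pow_le_pow_left₀ (abs_nonneg τ) hτ2.le 3
            norm_num at this
            exact this
          calc fK v ≤ 16 := norm_rieszK_line_le_sixteen hα v
            _ = 128 / 8 := by norm_num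
            _ ≤ 128 / |τ| ^ 3 := div_le_div_of_nonneg_left (by norm_num) hτ3 h8
      have h_P : ∫ v in s₁, f v ≤ cP := by
        have hpt : ∀ v ∈ s₁, f v ≤ 128 / |τ| ^ 3 * (1 / (1 - α) + 2 * K) := by
          intro v hv
          have hKv := hKP v hv
          rw [hmem₁] at hv
          have hζ : ‖riemannZeta (α + ((τ : ℂ) + v) * I)‖ ≤ 1 / (1 - α) + 2 * K := by
            have h := hK (τ + v)
            rw [← hζarg v] at h
            calc ‖riemannZeta (α + ((τ : ℂ) + v) * I)‖ ≤ 1 / (1 - α) + K * (1 + |τ + v|) := h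
              _ ≤ 1 / (1 - α) + K * (1 + 1) := by gcongr
              _ = 1 / (1 - α) + 2 * K := by ring
          simp only [hf]
          exact mul_le_mul hKv hζ (norm_nonneg _) (by positivity)
        have hc : IntegrableOn (fun _ : ℝ ↦ 128 / |τ| ^ 3 * (1 / (1 - α) + 2 * K)) s₁ :=
          continuous_const.integrableOn_Icc
        calc ∫ v in s₁, f v ≤ ∫ v in s₁, 128 / |τ| ^ 3 * (1 / (1 - α) + 2 * K) :=
              setIntegral_mono_on hfi.integrableOn hc hs₁m hpt
          _ = (volume.real s₁) * (128 / |τ| ^ 3 * (1 / (1 - α) + 2 * K)) := by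
              rw [setIntegral_const, smul_eq_mul]
          _ = 2 * (128 / |τ| ^ 3 * (1 / (1 - α) + 2 * K)) := by
              rw [hs₁, Real.volume_real_Icc_of_le (by linarith)]; ring
          _ = cP := by rw [hcP]; field_simp; ring
      -- the sup window `1 < |τ + v| ≤ 3T`
      have h_S : ∫ v in s₁ᶜ ∩ s₂, f v ≤ 8 * π * M := by
        have h1 : ∫ v in s₁ᶜ ∩ s₂, f v ≤ ∫ v in s₁ᶜ ∩ s₂, M * fK v := by
          refine setIntegral_mono_on (hfi.integrableOn) (hfKint.const_mul M).integrableOn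
            (hs₁m.compl.inter hs₂m) ?_
          intro v hv
          obtain ⟨hv1, hv2⟩ := hv
          rw [Set.mem_compl_iff, hmem₁, not_le] at hv1
          rw [hmem₂] at hv2
          have hζ := hM (τ + v) hv1.le hv2
          rw [← hζarg v] at hζ
          simp only [hf]
          rw [mul_comm]
          exact mul_le_mul_of_nonneg_right hζ (norm_nonneg _)
        have h2 : ∫ v in s₁ᶜ ∩ s₂, M * fK v ≤ ∫ v, M * fK v :=
          setIntegral_le_integral (hfKint.const_mul M) (Eventually.of_forall fun v ↦ by positivity)
        have h3 : ∫ v, M * fK v ≤ M * (8 * π) := by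
          rw [MeasureTheory.integral_const_mul]
          exact mul_le_mul_of_nonneg_left (integral_norm_rieszK_line_le hα) hM0
        linarith
      -- the far tail `|τ + v| > 3T`
      set gm : ℝ → ℝ := fun v ↦ (4 / (1 - α) / T + 16 * K) * (T ^ 2 + v ^ 2)⁻¹ with hgm
      have hgmint : Integrable gm :=
        (Literature.NumberTheory.LFunctions.RieszPerron.integrable_inv_sq_add_sq hT0.ne').const_mul _
      have hgm0 : ∀ v, 0 ≤ gm v := fun v ↦ by positivity
      have hfg : ∀ v ∈ s₁ᶜ \ s₂, f v ≤ gm v := by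
        intro v hv
        obtain ⟨-, hv2⟩ := hv
        rw [hmem₂, not_le] at hv2
        have hvT : T < |v| := by
          have := abs_add_le τ v
          linarith
        have hv0 : v ≠ 0 := fun h ↦ by rw [h, abs_zero] at hvT; linarith
        have hvp : 0 < |v| := abs_pos.2 hv0
        have hv1 : 1 ≤ |v| := by linarith
        have hKv : fK v ≤ 2 / |v| ^ 3 := ZeroDensity.norm_rieszK_le_two_div_cube α hv0
        have hζ : ‖riemannZeta (α + ((τ : ℂ) + v) * I)‖ ≤ 1 / (1 - α) + 4 * K * |v| := by
          have h := hK (τ + v)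
          rw [← hζarg v] at h
          have : |τ + v| ≤ |τ| + |v| := abs_add_le _ _
          have h2 : 1 + |τ + v| ≤ 4 * |v| := by linarith
          calc ‖riemannZeta (α + ((τ : ℂ) + v) * I)‖ ≤ 1 / (1 - α) + K * (1 + |τ + v|) := h
            _ ≤ 1 / (1 - α) + K * (4 * |v|) := by gcongr
            _ = 1 / (1 - α) + 4 * K * |v| := by ring
        have h1 : f v ≤ 2 / |v| ^ 3 * (1 / (1 - α) + 4 * K * |v|) := by
          simp only [hf]
          exact mul_le_mul hKv hζ (norm_nonneg _) (by positivity)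
        refine h1.trans ?_
        simp only [hgm]
        have hu2 : T ^ 2 + v ^ 2 ≤ 2 * |v| ^ 2 := by
          rw [sq_abs]
          have h' : T ^ 2 ≤ v ^ 2 := by
            rw [← sq_abs v]; exact pow_le_pow_left₀ (by positivity) hvT.le 2
          nlinarith
        have hpos : 0 < T ^ 2 + v ^ 2 := by positivity
        have hv3 : 0 < |v| ^ 3 := by positivity
        rw [div_mul_eq_mul_div, div_le_iff₀ hv3,
          show (4 / (1 - α) / T + 16 * K) * (T ^ 2 + v ^ 2)⁻¹ * |v| ^ 3 =
            ((4 / (1 - α) / T + 16 * K) * |v| ^ 3) / (T ^ 2 + v ^ 2) by ring,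
          le_div_iff₀ hpos]
        have ha : 1 / (1 - α) * (T ^ 2 + v ^ 2) ≤ 2 / (1 - α) / T * |v| ^ 3 := by
          rw [show 2 / (1 - α) / T * |v| ^ 3 = 1 / (1 - α) * (2 * |v| ^ 2 * (|v| / T)) by
            field_simp]
          refine mul_le_mul_of_nonneg_left ?_ (by positivity)
          have hvT' : 1 ≤ |v| / T := by rw [le_div_iff₀ hT0]; linarith
          calc T ^ 2 + v ^ 2 ≤ 2 * |v| ^ 2 := hu2
            _ = 2 * |v| ^ 2 * 1 := by ring
            _ ≤ 2 * |v| ^ 2 * (|v| / T) := by gcongr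
        have hb : 4 * K * |v| * (T ^ 2 + v ^ 2) ≤ 8 * K * |v| ^ 3 := by
          calc 4 * K * |v| * (T ^ 2 + v ^ 2) ≤ 4 * K * |v| * (2 * |v| ^ 2) := by gcongr
            _ = 8 * K * |v| ^ 3 := by ring
        calc 2 * (1 / (1 - α) + 4 * K * |v|) * (T ^ 2 + v ^ 2)
            = 2 * (1 / (1 - α) * (T ^ 2 + v ^ 2) + 4 * K * |v| * (T ^ 2 + v ^ 2)) := by ring
          _ ≤ 2 * (2 / (1 - α) / T * |v| ^ 3 + 8 * K * |v| ^ 3) := by gcongr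
          _ = (4 / (1 - α) / T + 16 * K) * |v| ^ 3 := by ring
      have h_F : ∫ v in s₁ᶜ \ s₂, f v ≤ π * cF := by
        calc ∫ v in s₁ᶜ \ s₂, f v ≤ ∫ v in s₁ᶜ \ s₂, gm v :=
              setIntegral_mono_on hfi.integrableOn hgmint.integrableOn (hs₁m.compl.diff hs₂m) hfg
          _ ≤ ∫ v, gm v := setIntegral_le_integral hgmint (Eventually.of_forall hgm0)
          _ = (4 / (1 - α) / T + 16 * K) * (π / T) := by
              simp only [hgm]
              rw [MeasureTheory.integral_const_mul, ZeroDensity.integral_inv_sq_add_sq_real hT0]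
          _ ≤ (4 / (1 - α) + 16 * K) * (π / T) := by
              have : 4 / (1 - α) / T ≤ 4 / (1 - α) := div_le_self (by positivity) hT
              gcongr
          _ = π * cF := by rw [hcF]; ring
      rw [hsplit₁, hsplit₂]
      linarith
    · rw [integral_undef hfi]; positivity
  have hint_g : ‖∫ v, g v‖ ≤ (Y : ℝ) ^ α * (cP + 8 * π * M + π * cF) := by
    calc ‖∫ v, g v‖ ≤ ∫ v, ‖g v‖ := norm_integral_le_integral_norm _
      _ = ∫ v, (Y : ℝ) ^ α * f v := integral_congr_ae (Eventually.of_forall hnorm_g)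
      _ = (Y : ℝ) ^ α * ∫ v, f v := MeasureTheory.integral_const_mul _ _
      _ ≤ (Y : ℝ) ^ α * (cP + 8 * π * M + π * cF) :=
          mul_le_mul_of_nonneg_left hfint (Real.rpow_nonneg hY0r.le _)
  have hc : ‖((1 / (2 * π) : ℝ) : ℂ)‖ = 1 / (2 * π) := by
    rw [Complex.norm_real, Real.norm_of_nonneg (by positivity)]
  calc ‖(Y : ℂ) ^ (1 - (τ : ℂ) * I) * rieszK (1 - (τ : ℂ) * I) +
        ((1 / (2 * π) : ℝ) : ℂ) * ∫ v, g v‖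
      ≤ ‖(Y : ℂ) ^ (1 - (τ : ℂ) * I) * rieszK (1 - (τ : ℂ) * I)‖ +
        ‖((1 / (2 * π) : ℝ) : ℂ) * ∫ v, g v‖ := norm_add_le _ _
    _ ≤ 2 * Y / |τ| ^ 3 + 1 / (2 * π) * ((Y : ℝ) ^ α * (cP + 8 * π * M + π * cF)) := by
        refine add_le_add hres ?_
        rw [norm_mul, hc]
        exact mul_le_mul_of_nonneg_left hint_g (by positivity)
    _ ≤ (2 * Y + (Y : ℝ) ^ α * ((128 / (1 - α) + 256 * K) / π)) / |τ| ^ 3 +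
        (Y : ℝ) ^ α * (4 * M + (2 / (1 - α) + 8 * K) / T) := by
        rw [hcP, hcF]
        have hπ : (0 : ℝ) < π := Real.pi_pos
        have hYα : 0 ≤ (Y : ℝ) ^ α := Real.rpow_nonneg hY0r.le _
        have e : 1 / (2 * π) * ((Y : ℝ) ^ α * ((256 / (1 - α) + 512 * K) / |τ| ^ 3 + 8 * π * M +
            π * ((4 / (1 - α) + 16 * K) / T))) =
            (Y : ℝ) ^ α * ((128 / (1 - α) + 256 * K) / π) / |τ| ^ 3 +
              (Y : ℝ) ^ α * (4 * M + (2 / (1 - α) + 8 * K) / T) := by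
          field_simp
          ring
        rw [e]
        have e2 : (2 * Y + (Y : ℝ) ^ α * ((128 / (1 - α) + 256 * K) / π)) / |τ| ^ 3 =
            2 * Y / |τ| ^ 3 + (Y : ℝ) ^ α * ((128 / (1 - α) + 256 * K) / π) / |τ| ^ 3 :=
          add_div _ _ _
        rw [e2]
        linarith

/-! ## Part C. The Class-I count with the kernel of Part B -/

/-- **The Class-I count by Halász's lemma with the kernel at the line `α` and the sup of `ζ` only
on `1 ≤ |t| ≤ 3T`** (Ivić (11.46)–(11.47): `R₁ ≪ max_M M^{2−2σ} log⁶ T` once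
`X^{2σ−1−α} ≫ M(α,3T) log⁵ T`, (11.48); the dyadic-block bookkeeping of
`NearOneDensity.classOne_count_line`). Let `1/2 ≤ α < 1`, `σ ≤ 1`, `α + 1 − 2σ ≤ 0`, blocks
`(X2^i, X2^{i+1}]`, `i < J`, with `X2^i < Y`, heights `U < Im ρ ≤ 2U` with `1 ≤ U ≤ 2T`, the
majorant `|ζ(α+it)| ≤ M` on `1 ≤ |t| ≤ 3T` and the crude bound with constant `K`; assume the
pole-window absorption `(128/(1−α)+256K)/π ≤ X^{1−α}`, the tail absorption `(2/(1−α)+8K)/T ≤ M`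
and the absorption condition `18 · 64 J² · 40 M X^{α+1−2σ} (1 + log 2Y)³ ≤ 1`. Then a `1`-spaced set
of Class-I points has at most `396288 J³ Y^{2−2σ}(1+log 2Y)³` elements.
[cite: Ivic1985, §11.4 (11.46)–(11.48)] [cite: Titchmarsh1986, §9.28] -/
theorem classOne_count' {α σ M K T : ℝ} (hα : 1 / 2 ≤ α) (hα1 : α < 1)
    (hσ1 : σ ≤ 1) (he : α + 1 - 2 * σ ≤ 0) (hT : 1 ≤ T)
    {X Y J : ℕ} (hX : 1 ≤ X) (hY : 1 ≤ Y) (hJ : ∀ i < J, X * 2 ^ i < Y) {U : ℝ}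
    (hUT : U ≤ 2 * T) (hM0 : 0 ≤ M) (hK0 : 0 ≤ K)
    (hM : ∀ t : ℝ, 1 ≤ |t| → |t| ≤ 3 * T → ‖riemannZeta ((α : ℂ) + t * I)‖ ≤ M)
    (hK : ∀ t : ℝ, ‖riemannZeta ((α : ℂ) + t * I)‖ ≤ 1 / (1 - α) + K * (1 + |t|))
    (hX5 : (128 / (1 - α) + 256 * K) / π ≤ (X : ℝ) ^ (1 - α))
    (hTM : (2 / (1 - α) + 8 * K) / T ≤ M)
    (habs : 18 * (64 * (J : ℝ) ^ 2) * (40 * M *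
      (X : ℝ) ^ (α + 1 - 2 * σ) * (1 + Real.log (2 * Y)) ^ 3) ≤ 1)
    (Z : Finset ℂ) (hZ : ∀ ρ ∈ Z, σ ≤ ρ.re ∧ ρ.re < 1 ∧ U < ρ.im ∧ ρ.im ≤ 2 * U)
    (hsep : ∀ ρ ∈ Z, ∀ ρ' ∈ Z, ρ ≠ ρ' → 1 ≤ |ρ.im - ρ'.im|)
    (hlarge : ∀ ρ ∈ Z, 1 / 8 ≤ ‖∑ n ∈ Finset.Ioc X (X * 2 ^ J),
      ZeroDensity.coeffB X Y n * (n : ℂ) ^ (-ρ)‖) :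
    (Z.card : ℝ) ≤ 396288 * (J : ℝ) ^ 3 * (Y : ℝ) ^ (2 - 2 * σ) * (1 + Real.log (2 * Y)) ^ 3 := by
  classical
  have h1α : 0 < 1 - α := by linarith
  set S' : ℕ → ℂ → ℂ := fun i ρ ↦ ∑ n ∈ Finset.Ioc (X * 2 ^ i) (X * 2 ^ (i + 1)),
    ZeroDensity.coeffB X Y n * (n : ℂ) ^ (-ρ) with hS'
  have hsplit : ∀ ρ, ∑ n ∈ Finset.Ioc X (X * 2 ^ J), ZeroDensity.coeffB X Y n * (n : ℂ) ^ (-ρ) =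
      ∑ i ∈ Finset.range J, S' i ρ := fun ρ ↦ ZeroDensity.sum_Ioc_mul_two_pow _ X J
  -- the case `J = 0` is vacuous
  rcases Nat.eq_zero_or_pos J with hJ0 | hJpos
  · subst hJ0
    have : Z = ∅ := by
      rw [Finset.eq_empty_iff_forall_notMem]
      intro ρ hρ
      have h := hlarge ρ hρ
      rw [hsplit ρ] at h
      simp at h
      linarith
    rw [this]; simp
  have hJr : (1 : ℝ) ≤ J := by exact_mod_cast hJpos
  have hY0 : (0 : ℝ) < Y := by exact_mod_cast (by omega : 0 < Y)
  have hY1r : (1 : ℝ) ≤ Y := by exact_mod_cast hY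
  have hX0 : (0 : ℝ) < X := by exact_mod_cast hX
  have hlog2Y : 0 ≤ 1 + Real.log (2 * Y) := by
    have : 0 ≤ Real.log (2 * Y) := Real.log_nonneg (by linarith)
    linarith
  -- pigeonhole
  set V : ℝ := 1 / (8 * J) with hV
  have hV0 : 0 < V := by positivity
  have hVsq : V ^ 2 = 1 / (64 * J ^ 2) := by rw [hV]; field_simp; ring
  have hpig : ∀ ρ ∈ Z, ∃ i ∈ Finset.range J, V ≤ ‖S' i ρ‖ := by
    intro ρ hρ
    by_contra hcon
    push Not at hcon
    have h1 := hlarge ρ hρ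
    rw [hsplit ρ] at h1
    have h2 : ‖∑ i ∈ Finset.range J, S' i ρ‖ < 1 / 8 := by
      calc ‖∑ i ∈ Finset.range J, S' i ρ‖ ≤ ∑ i ∈ Finset.range J, ‖S' i ρ‖ := norm_sum_le _ _
        _ < ∑ i ∈ Finset.range J, V := Finset.sum_lt_sum_of_nonempty ⟨0, by simp; omega⟩ hcon
        _ = J * V := by simp
        _ = 1 / 8 := by rw [hV]; field_simp
    linarith
  have hcover : Z ⊆ (Finset.range J).biUnion (fun i ↦ Z.filter (fun ρ ↦ V ≤ ‖S' i ρ‖)) := by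
    intro ρ hρ
    rw [Finset.mem_biUnion]
    obtain ⟨i, hi, hVi⟩ := hpig ρ hρ
    exact ⟨i, hi, Finset.mem_filter.2 ⟨hρ, hVi⟩⟩
  -- the per-block count
  have hblock : ∀ i ∈ Finset.range J, ((Z.filter (fun ρ ↦ V ≤ ‖S' i ρ‖)).card : ℝ) ≤
      396288 * J ^ 2 * (Y : ℝ) ^ (2 - 2 * σ) * (1 + Real.log (2 * Y)) ^ 3 := by
    intro i hi
    rw [Finset.mem_range] at hi
    set N : ℕ := X * 2 ^ i with hN
    have hN1 : 1 ≤ N := by rw [hN]; exact Nat.le_mul_of_pos_right X (by positivity) |>.trans' hX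
    have hNX : X ≤ N := by rw [hN]; exact Nat.le_mul_of_pos_right X (by positivity)
    have hNY : N < Y := hJ i hi
    have hN0 : (0 : ℝ) < N := by exact_mod_cast hN1
    have hN1r : (1 : ℝ) ≤ N := by exact_mod_cast hN1
    have hNXr : (X : ℝ) ≤ N := by exact_mod_cast hNX
    have hNYr : (N : ℝ) ≤ Y := by exact_mod_cast hNY.le
    have h2N : X * 2 ^ (i + 1) = 2 * N := by rw [hN]; ring
    set Zi := Z.filter (fun ρ ↦ V ≤ ‖S' i ρ‖) with hZi
    set G : ℝ := ∑ n ∈ Finset.Ioc N (2 * N), ‖ZeroDensity.coeffB X Y n‖ ^ 2 * (n : ℝ) ^ (-2 * σ)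
      with hG
    have hG0 : 0 ≤ G := Finset.sum_nonneg fun n _ ↦ by positivity
    have hGle : G ≤ 2 * (N : ℝ) ^ (1 - 2 * σ) * (1 + Real.log (2 * N)) ^ 3 :=
      NearOneDensity.sum_norm_coeffB_sq_le_log (by linarith) X Y hN1
    have hlogN : 1 + Real.log (2 * N) ≤ 1 + Real.log (2 * Y) := by
      have := Real.log_le_log (by positivity : (0 : ℝ) < 2 * N) (by linarith : (2 : ℝ) * N ≤ 2 * Y)
      linarith
    have hlogN0 : 0 ≤ 1 + Real.log (2 * N) := by
      have : 0 ≤ Real.log (2 * N) := Real.log_nonneg (by linarith)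
      linarith
    -- the kernel length `4N`
    have h4N0 : (0 : ℝ) < ((4 * N : ℕ) : ℝ) := by push_cast; positivity
    have h4Nα : (((4 * N : ℕ) : ℝ)) ^ α ≤ 4 * (N : ℝ) ^ α := by
      push_cast
      rw [Real.mul_rpow (by norm_num) hN0.le]
      refine mul_le_mul_of_nonneg_right ?_ (Real.rpow_nonneg hN0.le _)
      calc (4 : ℝ) ^ α ≤ (4 : ℝ) ^ (1 : ℝ) :=
            Real.rpow_le_rpow_of_exponent_le (by norm_num) hα1.le
        _ = 4 := Real.rpow_one _
    set Φ₁ : ℝ := (((4 * N : ℕ) : ℝ)) ^ α * (5 * M) with hΦ₁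
    have hΦ₁0 : 0 ≤ Φ₁ := by positivity
    set Φ₂ : ℝ := 12 * N with hΦ₂
    have hΦ₂0 : 0 ≤ Φ₂ := by positivity
    -- `(4N)^α c_K ≤ 4N` from the pole-window absorption
    have hcK : (((4 * N : ℕ) : ℝ)) ^ α * ((128 / (1 - α) + 256 * K) / π) ≤ ((4 * N : ℕ) : ℝ) := by
      have hX4N : (X : ℝ) ^ (1 - α) ≤ (((4 * N : ℕ) : ℝ)) ^ (1 - α) :=
        Real.rpow_le_rpow hX0.le (by push_cast; linarith) h1α.le
      calc (((4 * N : ℕ) : ℝ)) ^ α * ((128 / (1 - α) + 256 * K) / π)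
          ≤ (((4 * N : ℕ) : ℝ)) ^ α * (((4 * N : ℕ) : ℝ)) ^ (1 - α) :=
            mul_le_mul_of_nonneg_left (hX5.trans hX4N) (Real.rpow_nonneg h4N0.le _)
        _ = ((4 * N : ℕ) : ℝ) := by
            rw [← Real.rpow_add h4N0, show α + (1 - α) = 1 by ring, Real.rpow_one]
    -- the kernel bound at the line `α`
    have hker : ∀ τ : ℝ, 1 ≤ |τ| → |τ| ≤ U →
        ‖∑ n ∈ Finset.Icc 1 (4 * N), ((((1 : ℝ) - (n : ℝ) / (4 * N : ℕ)) ^ 2 : ℝ) : ℂ) *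
          (n : ℂ) ^ (-((τ : ℂ) * I))‖ ≤ Φ₂ / |τ| ^ 3 + Φ₁ := by
      intro τ h1 h2
      have hτ3 : 0 < |τ| ^ 3 := by positivity
      have h := norm_smoothedKernel_le_line' (Y := 4 * N) (by omega) hα hα1 hT hM0 hK0 hM hK h1
        (h2.trans hUT)
      refine h.trans (add_le_add ?_ ?_)
      · refine div_le_div_of_nonneg_right ?_ hτ3.le
        calc 2 * ((4 * N : ℕ) : ℝ) + (((4 * N : ℕ) : ℝ)) ^ α * ((128 / (1 - α) + 256 * K) / π)
            ≤ 2 * ((4 * N : ℕ) : ℝ) + ((4 * N : ℕ) : ℝ) := add_le_add le_rfl hcK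
          _ = Φ₂ := by rw [hΦ₂]; push_cast; ring
      · rw [hΦ₁]
        refine mul_le_mul_of_nonneg_left ?_ (Real.rpow_nonneg h4N0.le _)
        linarith
    -- the absorption condition for this block
    have habsN : 18 * Φ₁ * G ≤ V ^ 2 := by
      have hNe : (N : ℝ) ^ α * (N : ℝ) ^ (1 - 2 * σ) = (N : ℝ) ^ (α + 1 - 2 * σ) := by
        rw [← Real.rpow_add hN0]; congr 1; ring
      have hNX' : (N : ℝ) ^ (α + 1 - 2 * σ) ≤ (X : ℝ) ^ (α + 1 - 2 * σ) :=
        Real.rpow_le_rpow_of_nonpos hX0 hNXr he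
      calc 18 * Φ₁ * G ≤ 18 * (4 * (N : ℝ) ^ α * (5 * M)) * (2 * (N : ℝ) ^ (1 - 2 * σ) *
            (1 + Real.log (2 * N)) ^ 3) := by
            refine mul_le_mul (mul_le_mul_of_nonneg_left ?_ (by norm_num)) hGle hG0 (by positivity)
            exact mul_le_mul_of_nonneg_right h4Nα (by positivity)
        _ = 18 * (40 * M * ((N : ℝ) ^ α * (N : ℝ) ^ (1 - 2 * σ)) * (1 + Real.log (2 * N)) ^ 3) := by
            ring
        _ = 18 * (40 * M * (N : ℝ) ^ (α + 1 - 2 * σ) * (1 + Real.log (2 * N)) ^ 3) := by rw [hNe]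
        _ ≤ 18 * (40 * M * (X : ℝ) ^ (α + 1 - 2 * σ) * (1 + Real.log (2 * Y)) ^ 3) := by
            gcongr
        _ ≤ 1 / (64 * J ^ 2) := by
            rw [le_div_iff₀ (by positivity)]
            calc 18 * (40 * M * (X : ℝ) ^ (α + 1 - 2 * σ) * (1 + Real.log (2 * Y)) ^ 3) *
                  (64 * J ^ 2)
                = 18 * (64 * (J : ℝ) ^ 2) * (40 * M * (X : ℝ) ^ (α + 1 - 2 * σ) *
                    (1 + Real.log (2 * Y)) ^ 3) := by ring
              _ ≤ 1 := habs
        _ = V ^ 2 := hVsq.symm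
    have h1 := halasz_block_count' (ZeroDensity.coeffB X Y) hN1 (σ := σ) (U := U) (U₁ := U)
      hV0 hΦ₁0 hΦ₂0 Zi
      (fun ρ hρ ↦ by
        obtain ⟨hb, hb1, -, -⟩ := hZ ρ (Finset.mem_filter.1 hρ).1
        exact ⟨hb, by linarith⟩)
      (fun ρ hρ ↦ by
        obtain ⟨-, -, hg1, hg2⟩ := hZ ρ (Finset.mem_filter.1 hρ).1
        exact ⟨hg1.le, by linarith⟩)
      (fun ρ hρ ρ' hρ' hne ↦ hsep ρ (Finset.mem_filter.1 hρ).1 ρ' (Finset.mem_filter.1 hρ').1 hne)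
      hker
      (fun ρ hρ ↦ by
        have := (Finset.mem_filter.1 hρ).2
        simp only [hS', h2N] at this
        exact this)
      habsN
    -- `(72N + 252·12N) G / V² = 3096 N G/V² ≤ 396288 J² Y^{2−2σ} (1 + log 2Y)³`
    have hNe2 : (N : ℝ) * (N : ℝ) ^ (1 - 2 * σ) = (N : ℝ) ^ (2 - 2 * σ) := by
      rw [show (2 : ℝ) - 2 * σ = 1 + (1 - 2 * σ) by ring, Real.rpow_add hN0, Real.rpow_one]
    have hNY' : (N : ℝ) ^ (2 - 2 * σ) ≤ (Y : ℝ) ^ (2 - 2 * σ) :=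
      Real.rpow_le_rpow hN0.le hNYr (by linarith)
    calc (Zi.card : ℝ) ≤ (72 * N + 252 * Φ₂) * G / V ^ 2 := h1
      _ = 3096 * (64 * J ^ 2) * (N * G) := by rw [hVsq, hΦ₂]; field_simp; ring
      _ ≤ 3096 * (64 * J ^ 2) * (N * (2 * (N : ℝ) ^ (1 - 2 * σ) * (1 + Real.log (2 * N)) ^ 3)) := by
          gcongr
      _ = 396288 * J ^ 2 * ((N : ℝ) * (N : ℝ) ^ (1 - 2 * σ)) * (1 + Real.log (2 * N)) ^ 3 := by
          ring
      _ ≤ 396288 * J ^ 2 * (Y : ℝ) ^ (2 - 2 * σ) * (1 + Real.log (2 * Y)) ^ 3 := by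
          rw [hNe2]; gcongr
  -- sum over the blocks
  calc (Z.card : ℝ)
      ≤ ((Finset.range J).biUnion (fun i ↦ Z.filter (fun ρ ↦ V ≤ ‖S' i ρ‖))).card := by
        exact_mod_cast Finset.card_le_card hcover
    _ ≤ ∑ i ∈ Finset.range J, ((Z.filter (fun ρ ↦ V ≤ ‖S' i ρ‖)).card : ℝ) := by
        exact_mod_cast Finset.card_biUnion_le
    _ ≤ ∑ i ∈ Finset.range J, 396288 * J ^ 2 * (Y : ℝ) ^ (2 - 2 * σ) * (1 + Real.log (2 * Y)) ^ 3 :=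
        Finset.sum_le_sum hblock
    _ = _ := by rw [Finset.sum_const, Finset.card_range, nsmul_eq_mul]; ring

/-! ## Part D. Class II counted: large values of `M_X` on the line `α`, on average over the window -/

/-- **The Class-II integral against the majorant `M` and the far tails** (Ivić (11.45) ⟹ the
display before (11.49): "`M_X(α+it_r) ≫ Y^{σ−α}(M(α,2T) log T)^{−1}`", here kept INTEGRATED over the
window instead of evaluated at a maximising point). Let `1/2 ≤ α < σ ≤ Re ρ < 1`, `U < Im ρ ≤ 2U`,
`2 ≤ U ≤ T`, `X ≥ 1`; suppose `|ζ(α+it)| ≤ M` for `1 ≤ |t| ≤ 3T` and the crude bound with constant `K`.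
If the Class-II integral is at least `A > 0`, then
`A ≤ M ∫ k(y) |M_X(α+i(γ+y))| dy + (1 + X^{1−α}/(1−α)) · π(8/(1−α)+48K)/U`, where
`k(y) = 2/((σ−α)((σ−α)²+y²))` majorises `|K(α−β+iy)|` (`ZeroDensity.norm_rieszK_neg_line_le`): on the
window `1 ≤ γ + y ≤ 3T` the factor `|ζ|` is `≤ M`; off it `|y| > U/2` and the kernel decay `2/|y|³`
with the crude bound gives the tail (as in `NearOneDetect.classTwo_integral_le_line`).
[cite: Ivic1985, §11.4 (11.45) and (11.49)] -/
theorem classTwo_reduce {σ α M K T U : ℝ} (hα : 1 / 2 ≤ α) (hασ : α < σ)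
    (hM0 : 0 ≤ M) (hK0 : 0 ≤ K) (X : ℕ) (hU : 2 ≤ U) (hUT : U ≤ T)
    (hM : ∀ t : ℝ, 1 ≤ |t| → |t| ≤ 3 * T → ‖riemannZeta ((α : ℂ) + t * I)‖ ≤ M)
    (hK : ∀ t : ℝ, ‖riemannZeta ((α : ℂ) + t * I)‖ ≤ 1 / (1 - α) + K * (1 + |t|))
    {ρ : ℂ} (hβ : σ ≤ ρ.re) (hβ1 : ρ.re < 1) (hγ1 : U < ρ.im) (hγ2 : ρ.im ≤ 2 * U)
    {A : ℝ} (hA0 : 0 < A)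
    (hA : A ≤ ∫ y : ℝ, ‖rieszK (((α - ρ.re : ℝ) : ℂ) + y * I)‖ *
      (‖riemannZeta (α + (ρ.im + y) * I)‖ * ‖mollifier X (α + (ρ.im + y) * I)‖)) :
    A ≤ M * (∫ y : ℝ, 2 / ((σ - α) * ((σ - α) ^ 2 + y ^ 2)) * ‖mollifier X (α + (ρ.im + y) * I)‖) +
      (1 + (X : ℝ) ^ (1 - α) / (1 - α)) * (π * (8 / (1 - α) + 48 * K) / U) := by
  have hα1 : α < 1 := by linarith
  have h1α : 0 < 1 - α := by linarith
  have hU0 : 0 < U := by linarith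
  have hγ0 : 0 ≤ ρ.im := by linarith
  set η : ℝ := ρ.re - α with hη
  have hη0 : 0 < η := by rw [hη]; linarith
  have hη2 : η ≤ 1 / 2 := by rw [hη]; linarith
  have hησ : σ - α ≤ η := by rw [hη]; linarith
  have hσα : 0 < σ - α := by linarith
  have haη : α - ρ.re = -η := by rw [hη]; ring
  set mX : ℝ := 1 + (X : ℝ) ^ (1 - α) / (1 - α) with hmX
  have hmX0 : 0 ≤ mX := by positivity
  set kf : ℝ → ℝ := fun y ↦ 2 / ((σ - α) * ((σ - α) ^ 2 + y ^ 2)) with hkf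
  have hkf0 : ∀ y, 0 ≤ kf y := fun y ↦ by positivity
  set mf : ℝ → ℝ := fun y ↦ ‖mollifier X ((α : ℂ) + (ρ.im + y) * I)‖ with hmf
  set f : ℝ → ℝ := fun y ↦ ‖rieszK (((α - ρ.re : ℝ) : ℂ) + y * I)‖ *
      (‖riemannZeta (α + (ρ.im + y) * I)‖ * ‖mollifier X (α + (ρ.im + y) * I)‖) with hf
  have hf0 : ∀ y, 0 ≤ f y := fun y ↦ by positivity
  -- integrability is forced by `A > 0`
  have hint : Integrable f := by
    by_contra h
    rw [integral_undef h] at hA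
    linarith
  -- the mollifier: bounded and continuous
  have hM_le : ∀ y : ℝ, mf y ≤ mX := by
    intro y
    rcases Nat.eq_zero_or_pos X with hX0 | hX1
    · subst hX0
      simp only [hmf, mollifier, show Finset.Icc 1 0 = ∅ by rfl, Finset.sum_empty, norm_zero]
      exact hmX0
    · have h := norm_mollifier_le_rpow hX1 (s := (α : ℂ) + (ρ.im + y) * I) (by simp; linarith)
        (by simp; linarith)
      simpa [hmX, hmf] using h
  have hmfc : Continuous mf := by
    have : Continuous fun y : ℝ ↦ mollifier X ((α : ℂ) + (ρ.im + y) * I) :=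
      (differentiable_mollifier X).continuous.comp (by fun_prop)
    exact this.norm
  have hkfc : Continuous kf := by
    simp only [hkf]
    exact Continuous.div continuous_const (by fun_prop) fun y ↦ by positivity
  have hkfint : Integrable kf := by
    have h := (Literature.NumberTheory.LFunctions.RieszPerron.integrable_inv_sq_add_sq
      hσα.ne').const_mul (2 / (σ - α))
    refine h.congr (Eventually.of_forall fun y ↦ ?_)
    simp only [hkf]
    field_simp
  have hkmint : Integrable fun y ↦ kf y * mf y :=
    hkfint.mul_bdd hmfc.aestronglyMeasurable (Eventually.of_forall fun y ↦ by
      rw [Real.norm_of_nonneg (norm_nonneg _)]; exact hM_le y)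
  -- the kernel against `kf`
  have hKk : ∀ y : ℝ, ‖rieszK (((α - ρ.re : ℝ) : ℂ) + y * I)‖ ≤ kf y := by
    intro y
    rw [haη]
    exact ZeroDensity.norm_rieszK_neg_line_le hσα hησ hη2 y
  -- split at the window `1 ≤ γ + y ≤ 3T`
  set s : Set ℝ := Set.Icc (1 - ρ.im) (3 * T - ρ.im) with hs
  have hsm : MeasurableSet s := measurableSet_Icc
  have hsplit : ∫ y, f y = (∫ y in s, f y) + ∫ y in sᶜ, f y := (integral_add_compl hsm hint).symm
  -- the window
  have hin : ∫ y in s, f y ≤ M * ∫ y, kf y * mf y := by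
    have hpt : ∀ y ∈ s, f y ≤ M * (kf y * mf y) := by
      intro y hy
      obtain ⟨hy1, hy2⟩ := hy
      have ht1 : 1 ≤ ρ.im + y := by linarith
      have ht2 : ρ.im + y ≤ 3 * T := by linarith
      have hζ : ‖riemannZeta ((α : ℂ) + (ρ.im + y) * I)‖ ≤ M := by
        have h1 := hM (ρ.im + y) (by rw [abs_of_pos (by linarith)]; exact ht1)
          (by rw [abs_of_pos (by linarith)]; exact ht2)
        push_cast at h1
        exact h1
      simp only [hf]
      calc ‖rieszK (((α - ρ.re : ℝ) : ℂ) + y * I)‖ *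
            (‖riemannZeta (α + (ρ.im + y) * I)‖ * ‖mollifier X (α + (ρ.im + y) * I)‖)
          ≤ kf y * (M * mf y) :=
            mul_le_mul (hKk y) (mul_le_mul_of_nonneg_right hζ (norm_nonneg _)) (by positivity)
              (hkf0 y)
        _ = M * (kf y * mf y) := by ring
    calc ∫ y in s, f y ≤ ∫ y in s, M * (kf y * mf y) :=
          setIntegral_mono_on hint.integrableOn (hkmint.const_mul M).integrableOn hsm hpt
      _ ≤ ∫ y, M * (kf y * mf y) :=
          setIntegral_le_integral (hkmint.const_mul M) (Eventually.of_forall fun y ↦ by positivity)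
      _ = M * ∫ y, kf y * mf y := integral_const_mul _ _
  -- the far tails `|y| > U/2`
  set W : ℝ := U / 2 with hW
  have hW1 : 1 ≤ W := by rw [hW]; linarith
  have hW0 : 0 < W := by linarith
  set P : ℝ := 1 / (1 - α) + K * (1 + 2 * U) with hP
  have hP0 : 0 ≤ P := by positivity
  set g : ℝ → ℝ := fun y ↦ mX * (4 * P / W + 4 * K) * (W ^ 2 + y ^ 2)⁻¹ with hg
  have hgint : Integrable g :=
    (Literature.NumberTheory.LFunctions.RieszPerron.integrable_inv_sq_add_sq hW0.ne').const_mul _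
  have hg0 : ∀ y, 0 ≤ g y := fun y ↦ by positivity
  have hfg : ∀ y ∈ sᶜ, f y ≤ g y := by
    intro y hy
    have hyW : W < |y| := by
      simp only [hs, Set.mem_compl_iff, Set.mem_Icc, not_and_or, not_le] at hy
      rcases hy with hy | hy
      · rw [abs_of_neg (by linarith)]; rw [hW]; linarith
      · rw [abs_of_pos (by linarith)]; rw [hW]; linarith
    have hy0 : y ≠ 0 := fun h ↦ by rw [h, abs_zero] at hyW; linarith
    have hyp : 0 < |y| := abs_pos.2 hy0
    have hKy := ZeroDensity.norm_rieszK_le_two_div_cube (α - ρ.re) hy0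
    have hζ : ‖riemannZeta ((α : ℂ) + (ρ.im + y) * I)‖ ≤ P + K * |y| := by
      have h1 := hK (ρ.im + y)
      push_cast at h1
      have hγy : |ρ.im + y| ≤ 2 * U + |y| :=
        (abs_add_le _ _).trans (by rw [abs_of_nonneg hγ0]; linarith)
      calc ‖riemannZeta ((α : ℂ) + (ρ.im + y) * I)‖ ≤ 1 / (1 - α) + K * (1 + |ρ.im + y|) := h1
        _ ≤ 1 / (1 - α) + K * (1 + (2 * U + |y|)) := by gcongr
        _ = P + K * |y| := by rw [hP]; ring
    have h1 : f y ≤ 2 / |y| ^ 3 * ((P + K * |y|) * mX) := by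
      simp only [hf]
      exact mul_le_mul hKy (mul_le_mul hζ (hM_le y) (norm_nonneg _) (by positivity))
        (by positivity) (by positivity)
    refine h1.trans ?_
    simp only [hg]
    have hy2 : W ^ 2 + y ^ 2 ≤ 2 * |y| ^ 2 := by
      have h := pow_lt_pow_left₀ hyW (by linarith) two_ne_zero
      rw [sq_abs] at h ⊢
      linarith
    have hpos : 0 < W ^ 2 + y ^ 2 := by positivity
    have hy3 : 0 < |y| ^ 3 := by positivity
    rw [div_mul_eq_mul_div, div_le_iff₀ hy3,
      show mX * (4 * P / W + 4 * K) * (W ^ 2 + y ^ 2)⁻¹ * |y| ^ 3 =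
        mX * ((4 * P / W + 4 * K) * |y| ^ 3) / (W ^ 2 + y ^ 2) by ring,
      le_div_iff₀ hpos]
    have hPU : P * (W ^ 2 + y ^ 2) ≤ 2 * P / W * |y| ^ 3 := by
      rw [show 2 * P / W * |y| ^ 3 = P * (2 * |y| ^ 2 * |y| / W) by ring]
      refine mul_le_mul_of_nonneg_left ?_ hP0
      rw [le_div_iff₀ hW0]
      calc (W ^ 2 + y ^ 2) * W ≤ (2 * |y| ^ 2) * |y| :=
            mul_le_mul hy2 hyW.le hW0.le (by positivity)
        _ = 2 * |y| ^ 2 * |y| := by ring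
    have hKU : K * |y| * (W ^ 2 + y ^ 2) ≤ 2 * K * |y| ^ 3 := by
      calc K * |y| * (W ^ 2 + y ^ 2) ≤ K * |y| * (2 * |y| ^ 2) := by gcongr
        _ = 2 * K * |y| ^ 3 := by ring
    calc 2 * ((P + K * |y|) * mX) * (W ^ 2 + y ^ 2)
        = 2 * mX * (P * (W ^ 2 + y ^ 2) + K * |y| * (W ^ 2 + y ^ 2)) := by ring
      _ ≤ 2 * mX * (2 * P / W * |y| ^ 3 + 2 * K * |y| ^ 3) := by gcongr
      _ = mX * ((4 * P / W + 4 * K) * |y| ^ 3) := by ring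
  have htail : ∫ y in sᶜ, f y ≤ mX * (π * (8 / (1 - α) + 48 * K) / U) := by
    calc ∫ y in sᶜ, f y ≤ ∫ y in sᶜ, g y :=
          setIntegral_mono_on hint.integrableOn hgint.integrableOn hsm.compl hfg
      _ ≤ ∫ y, g y := setIntegral_le_integral hgint (Eventually.of_forall hg0)
      _ = mX * (4 * P / W + 4 * K) * (π / W) := by
          simp only [hg]
          rw [integral_const_mul, ZeroDensity.integral_inv_sq_add_sq_real hW0]
      _ ≤ mX * (4 / (1 - α) + 24 * K) * (π / W) := by
          have hPU' : 4 * P / W + 4 * K ≤ 4 / (1 - α) + 24 * K := by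
            rw [hP, hW]
            have h1 : 4 * (1 / (1 - α) + K * (1 + 2 * U)) / (U / 2) =
                8 / (1 - α) / U + 8 * K * ((1 + 2 * U) / U) := by
              field_simp
              ring
            rw [h1]
            have h2 : 8 / (1 - α) / U ≤ 4 / (1 - α) := by
              rw [div_le_iff₀ hU0, div_mul_eq_mul_div, div_le_div_iff_of_pos_right h1α]
              linarith
            have h3 : (1 + 2 * U) / U ≤ 5 / 2 := by
              rw [div_le_iff₀ hU0]; linarith
            have h3' : 8 * K * ((1 + 2 * U) / U) ≤ 8 * K * (5 / 2) :=
              mul_le_mul_of_nonneg_left h3 (by positivity)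
            linarith
          gcongr
      _ = mX * (π * (8 / (1 - α) + 48 * K) / U) := by rw [hW]; field_simp; ring
  rw [hsplit] at hA
  calc A ≤ (∫ y in s, f y) + ∫ y in sᶜ, f y := hA
    _ ≤ M * (∫ y, kf y * mf y) + mX * (π * (8 / (1 - α) + 48 * K) / U) := add_le_add hin htail

/-- **Dyadic decomposition of the mollifier**: for `X ≤ 2^{J}`,
`|M_X(s)| ≤ 1 + ∑_{j<J} |∑_{2^j < n ≤ 2^{j+1}, n ≤ X} μ(n) n^{−s}|` (the term `n = 1` apart; Ivić's
"there is a number `N` (`1 ≪ N ≤ X`)" before (11.49), in summed form). [cite: Ivic1985, §11.4 (11.49)] -/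
theorem norm_mollifier_le_one_add_sum_blocks {X J : ℕ} (hX : 1 ≤ X) (hJ : X ≤ 2 ^ J) (s : ℂ) :
    ‖mollifier X s‖ ≤ 1 + ∑ j ∈ Finset.range J, ‖∑ n ∈ Finset.Ioc (2 ^ j) (2 * 2 ^ j),
      (if n ≤ X then ((ArithmeticFunction.moebius n : ℤ) : ℂ) else 0) * (n : ℂ) ^ (-s)‖ := by
  classical
  simp only [← pow_succ']
  set b : ℕ → ℂ := fun n ↦ if n ≤ X then ((ArithmeticFunction.moebius n : ℤ) : ℂ) else 0 with hb
  have hsplit : mollifier X s = 1 + ∑ n ∈ Finset.Ioc 1 (1 * 2 ^ J), b n * (n : ℂ) ^ (-s) := by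
    unfold mollifier
    rw [Finset.Icc_eq_cons_Ioc hX, Finset.sum_cons]
    have h1 : ((ArithmeticFunction.moebius 1 : ℤ) : ℂ) * ((1 : ℕ) : ℂ) ^ (-s) = 1 := by
      simp
    rw [h1, one_mul]
    congr 1
    have hsub : Finset.Ioc 1 X ⊆ Finset.Ioc 1 (2 ^ J) := Finset.Ioc_subset_Ioc_right hJ
    rw [← Finset.sum_subset hsub]
    · refine Finset.sum_congr rfl fun n hn ↦ ?_
      simp only [Finset.mem_Ioc] at hn
      simp [hb, hn.2]
    · intro n hn hn'
      simp only [Finset.mem_Ioc, not_and_or, not_le] at hn hn'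
      have : ¬ n ≤ X := by omega
      simp [hb, this]
  rw [hsplit, ZeroDensity.sum_Ioc_mul_two_pow _ 1 J]
  simp only [one_mul]
  calc ‖1 + ∑ i ∈ Finset.range J, ∑ n ∈ Finset.Ioc (2 ^ i) (2 ^ (i + 1)), b n * (n : ℂ) ^ (-s)‖
      ≤ ‖(1 : ℂ)‖ + ‖∑ i ∈ Finset.range J, ∑ n ∈ Finset.Ioc (2 ^ i) (2 ^ (i + 1)), b n * (n : ℂ) ^ (-s)‖ :=
        norm_add_le _ _
    _ ≤ 1 + ∑ i ∈ Finset.range J, ‖∑ n ∈ Finset.Ioc (2 ^ i) (2 ^ (i + 1)), b n * (n : ℂ) ^ (-s)‖ := by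
        rw [norm_one]; exact add_le_add le_rfl (norm_sum_le _ _)

/-- **Mean square of a Möbius block over `1`-spaced points of the line `Re s = α`, shifted by
`y`** (the Halász–Montgomery step behind Ivić (11.49)–(11.50), in mean-square form and uniformly in
the shift `y`: the differences of the shifted ordinates do not depend on `y`). For `N ≥ 1`, points
`ρ` with ordinates in `[U₁, U₁ + U]` pairwise `≥ 1` apart, `U ≤ 2T`, and the majorant/crude bounds of
`norm_smoothedKernel_le_line'`:
`∑_ρ |∑_{N<n≤2N, n≤X} μ(n) n^{−α−i(γ_ρ+y)}|² ≤ 4 (4N + 14Φ₂ + |Z|Φ₁) N^{1−2α}` with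
`Φ₂ = 2·4N + (4N)^α(128/(1−α)+256K)/π`, `Φ₁ = (4N)^α(4M + (2/(1−α)+8K)/T)`
(`HalaszTuranLH.sum_norm_sq_le_of_smoothedKernel_bound` + `HalaszTuranLH.rowsum_le`; `|μ(n)| ≤ 1`).
[cite: Ivic1985, §11.4 (11.49)–(11.50)] [cite: IwaniecKowalski2004, Theorem 9.6] -/
theorem moebiusBlock_meanSquare {α M K T U U₁ : ℝ} (hα : 1 / 2 ≤ α) (hα1 : α < 1) (hT : 1 ≤ T)
    (hM0 : 0 ≤ M) (hK0 : 0 ≤ K) (hUT : U ≤ 2 * T)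
    (hM : ∀ t : ℝ, 1 ≤ |t| → |t| ≤ 3 * T → ‖riemannZeta ((α : ℂ) + t * I)‖ ≤ M)
    (hK : ∀ t : ℝ, ‖riemannZeta ((α : ℂ) + t * I)‖ ≤ 1 / (1 - α) + K * (1 + |t|))
    (b : ℕ → ℂ) (hb1 : ∀ n, ‖b n‖ ≤ 1) {N : ℕ} (hN : 1 ≤ N) (Z : Finset ℂ)
    (him : ∀ ρ ∈ Z, U₁ ≤ ρ.im ∧ ρ.im ≤ U₁ + U)
    (hsep : ∀ ρ ∈ Z, ∀ ρ' ∈ Z, ρ ≠ ρ' → 1 ≤ |ρ.im - ρ'.im|) (y : ℝ) :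
    ∑ ρ ∈ Z, ‖∑ n ∈ Finset.Ioc N (2 * N), b n * (n : ℂ) ^ (-((α : ℂ) + (ρ.im + y) * I))‖ ^ 2 ≤
      4 * (4 * N + 14 * (2 * ((4 * N : ℕ) : ℝ) + (((4 * N : ℕ) : ℝ)) ^ α *
        ((128 / (1 - α) + 256 * K) / π)) +
        Z.card * ((((4 * N : ℕ) : ℝ)) ^ α * (4 * M + (2 / (1 - α) + 8 * K) / T))) *
        (N : ℝ) ^ (1 - 2 * α) := by
  classical
  have h1α : 0 < 1 - α := by linarith
  have hN0 : (0 : ℝ) < N := by exact_mod_cast hN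
  have h4N0 : (0 : ℝ) < ((4 * N : ℕ) : ℝ) := by push_cast; positivity
  set Φ₂ : ℝ := 2 * ((4 * N : ℕ) : ℝ) + (((4 * N : ℕ) : ℝ)) ^ α * ((128 / (1 - α) + 256 * K) / π)
    with hΦ₂
  set Φ₁ : ℝ := (((4 * N : ℕ) : ℝ)) ^ α * (4 * M + (2 / (1 - α) + 8 * K) / T) with hΦ₁
  have hΦ₂0 : 0 ≤ Φ₂ := by positivity
  have hΦ₁0 : 0 ≤ Φ₁ := by positivity
  -- the shifted ordinates
  set 𝒯 : Finset ℝ := Z.image (fun ρ ↦ ρ.im + y) with h𝒯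
  have hinj : Set.InjOn (fun ρ : ℂ ↦ ρ.im + y) Z := by
    intro ρ hρ ρ' hρ' h
    by_contra hne
    have := hsep ρ hρ ρ' hρ' hne
    have h' : ρ.im = ρ'.im := by simpa using h
    rw [h', sub_self, abs_zero] at this
    linarith
  have hcardT : 𝒯.card = Z.card := Finset.card_image_of_injOn hinj
  have hsepT : ∀ t ∈ 𝒯, ∀ t' ∈ 𝒯, t ≠ t' → 1 ≤ |t - t'| := by
    intro t ht t' ht' hne
    simp only [h𝒯, Finset.mem_image] at ht ht'
    obtain ⟨ρ, hρ, rfl⟩ := ht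
    obtain ⟨ρ', hρ', rfl⟩ := ht'
    have : ρ.im + y - (ρ'.im + y) = ρ.im - ρ'.im := by ring
    rw [this]
    exact hsep ρ hρ ρ' hρ' fun h ↦ hne (by rw [h])
  have hmemT : ∀ t ∈ 𝒯, U₁ + y ≤ t ∧ t ≤ U₁ + y + U := by
    intro t ht
    simp only [h𝒯, Finset.mem_image] at ht
    obtain ⟨ρ, hρ, rfl⟩ := ht
    obtain ⟨h1, h2⟩ := him ρ hρ
    constructor <;> linarith
  -- the row-sum bound
  set B : ℝ := 4 * N + 14 * Φ₂ + Z.card * Φ₁ with hB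
  have hB0 : 0 ≤ B := by rw [hB]; positivity
  have hrow : ∀ t ∈ 𝒯, ∑ t' ∈ 𝒯, ‖∑ n ∈ Finset.Icc 1 (4 * N),
      ((((1 : ℝ) - (n : ℝ) / (4 * N : ℕ)) ^ 2 : ℝ) : ℂ) * (n : ℂ) ^ (-(((t - t' : ℝ) : ℂ) * I))‖ ≤ B := by
    intro t ht
    have h := rowsum_le 𝒯 hsepT (g := fun τ ↦ ‖∑ n ∈ Finset.Icc 1 (4 * N),
      ((((1 : ℝ) - (n : ℝ) / (4 * N : ℕ)) ^ 2 : ℝ) : ℂ) * (n : ℂ) ^ (-((τ : ℂ) * I))‖)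
      (D := 4 * N) (Φ₁ := Φ₁) (Φ₂ := Φ₂) hΦ₁0 hΦ₂0
      (by
        have := norm_smoothedKernel_le_self (4 * N) 0
        push_cast at this ⊢
        exact this)
      (by
        intro t₁ ht₁ t₂ ht₂ hne
        have h1 : 1 ≤ |t₁ - t₂| := hsepT t₁ ht₁ t₂ ht₂ hne
        have h2 : |t₁ - t₂| ≤ 2 * T := by
          obtain ⟨ha1, ha2⟩ := hmemT t₁ ht₁
          obtain ⟨hb1, hb2⟩ := hmemT t₂ ht₂
          have : |t₁ - t₂| ≤ U := by rw [abs_le]; constructor <;> linarith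
          linarith
        exact norm_smoothedKernel_le_line' (Y := 4 * N) (by omega) hα hα1 hT hM0 hK0 hM hK h1 h2)
      ht
    rw [hcardT] at h
    simpa only [hB] using h
  -- the coefficients `a(n) = b(n) n^{-α}` on `N < n ≤ 2N`
  set a : ℕ → ℂ := fun n ↦ if N < n ∧ n ≤ 2 * N then b n * (((n : ℝ) ^ (-α) : ℝ) : ℂ) else 0
    with ha
  have hS_eq : ∀ t : ℝ, ∑ n ∈ Finset.Icc 1 (2 * N), a n * (n : ℂ) ^ (-((t : ℂ) * I)) =
      ∑ n ∈ Finset.Ioc N (2 * N), b n * (n : ℂ) ^ (-((α : ℂ) + t * I)) := by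
    intro t
    simp only [ha]
    rw [← Finset.sum_filter_add_sum_filter_not (Finset.Icc 1 (2 * N)) (fun n ↦ N < n ∧ n ≤ 2 * N)]
    have e : (Finset.Icc 1 (2 * N)).filter (fun n ↦ N < n ∧ n ≤ 2 * N) = Finset.Ioc N (2 * N) := by
      ext n; simp; omega
    rw [e]
    have h0 : ∑ n ∈ (Finset.Icc 1 (2 * N)).filter (fun n ↦ ¬ (N < n ∧ n ≤ 2 * N)),
        (if N < n ∧ n ≤ 2 * N then b n * (((n : ℝ) ^ (-α) : ℝ) : ℂ) else 0) *
          (n : ℂ) ^ (-((t : ℂ) * I)) = 0 :=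
      Finset.sum_eq_zero fun n hn ↦ by
        simp only [Finset.mem_filter] at hn; simp [hn.2]
    rw [h0, add_zero]
    refine Finset.sum_congr rfl fun n hn ↦ ?_
    have hn' := hn
    simp only [Finset.mem_Ioc] at hn'
    rw [if_pos hn']
    have hcp := ZeroDensity.natCast_cpow_neg_eq n (by omega) ((α : ℂ) + t * I) α
    have hre : ((α : ℂ) + t * I).re = α := by simp
    have him' : ((α : ℂ) + t * I).im = t := by simp
    rw [hre, him', sub_self, neg_zero, Real.rpow_zero] at hcp
    rw [hcp]
    push_cast
    ring
  -- the weighted duality inequality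
  have h1 := sum_norm_sq_le_of_smoothedKernel_bound (2 * N) (4 * N) (by omega) a 𝒯 hB0 hrow
  have hsuma : ∑ n ∈ Finset.Icc 1 (2 * N), ‖a n‖ ^ 2 ≤ (N : ℝ) ^ (1 - 2 * α) := by
    calc ∑ n ∈ Finset.Icc 1 (2 * N), ‖a n‖ ^ 2
        ≤ ∑ n ∈ Finset.Icc 1 (2 * N), (if N < n then (N : ℝ) ^ (-2 * α) else 0) := by
          refine Finset.sum_le_sum fun n hn ↦ ?_
          simp only [ha]
          by_cases h : N < n ∧ n ≤ 2 * N
          · rw [if_pos h, if_pos h.1, norm_mul, mul_pow, Complex.norm_real,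
              Real.norm_of_nonneg (Real.rpow_nonneg (Nat.cast_nonneg n) _),
              ZeroDensity.rpow_neg_sq (Nat.cast_nonneg n)]
            have hn0 : (0 : ℝ) < n := by exact_mod_cast (by omega : 0 < n)
            have hnN : (N : ℝ) ≤ n := by exact_mod_cast h.1.le
            have e1 : ‖b n‖ ^ 2 ≤ 1 := by
              have := hb1 n
              have h0 := norm_nonneg (b n)
              nlinarith
            have e2 : (n : ℝ) ^ (-2 * α) ≤ (N : ℝ) ^ (-2 * α) :=
              Real.rpow_le_rpow_of_nonpos hN0 hnN (by linarith)
            calc ‖b n‖ ^ 2 * (n : ℝ) ^ (-2 * α) ≤ 1 * (N : ℝ) ^ (-2 * α) :=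
                  mul_le_mul e1 e2 (Real.rpow_nonneg hn0.le _) zero_le_one
              _ = (N : ℝ) ^ (-2 * α) := one_mul _
          · rw [if_neg h, norm_zero]
            split_ifs
            · simp only [ne_eq, OfNat.ofNat_ne_zero, not_false_eq_true, zero_pow]
              positivity
            · simp
      _ = ∑ n ∈ (Finset.Icc 1 (2 * N)).filter (fun n ↦ N < n), (N : ℝ) ^ (-2 * α) :=
          (Finset.sum_filter _ _).symm
      _ = ((Finset.Ioc N (2 * N)).card : ℝ) * (N : ℝ) ^ (-2 * α) := by
          have e : (Finset.Icc 1 (2 * N)).filter (fun n ↦ N < n) = Finset.Ioc N (2 * N) := by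
            ext n; simp; omega
          rw [Finset.sum_const, nsmul_eq_mul, e]
      _ = (N : ℝ) ^ (1 - 2 * α) := by
          rw [Nat.card_Ioc, show 2 * N - N = N by omega,
            show (1 : ℝ) - 2 * α = 1 + (-2 * α) by ring, Real.rpow_add hN0, Real.rpow_one]
  -- assemble
  have key : ∑ t ∈ 𝒯, ‖∑ n ∈ Finset.Icc 1 (2 * N), a n * (n : ℂ) ^ (-((t : ℂ) * I))‖ ^ 2 =
      ∑ ρ ∈ Z, ‖∑ n ∈ Finset.Ioc N (2 * N), b n * (n : ℂ) ^ (-((α : ℂ) + (ρ.im + y) * I))‖ ^ 2 := by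
    rw [h𝒯, Finset.sum_image hinj]
    refine Finset.sum_congr rfl fun ρ _ ↦ ?_
    rw [hS_eq (ρ.im + y)]
    push_cast
    rfl
  rw [← key]
  calc ∑ t ∈ 𝒯, ‖∑ n ∈ Finset.Icc 1 (2 * N), a n * (n : ℂ) ^ (-((t : ℂ) * I))‖ ^ 2
      ≤ 4 * B * ∑ n ∈ Finset.Icc 1 (2 * N), ‖a n‖ ^ 2 := h1
    _ ≤ 4 * B * (N : ℝ) ^ (1 - 2 * α) := mul_le_mul_of_nonneg_left hsuma (by positivity)

/-- AM–GM absorption: `0 ≤ x`, `x² ≤ P·Q` ⇒ `x ≤ (θP + Q/θ)/2` for every `θ > 0`. [folklore] -/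
private theorem le_half_of_sq_le_mul {x P Q θ : ℝ} (hx : 0 ≤ x) (hP : 0 ≤ P) (hQ : 0 ≤ Q)
    (hθ : 0 < θ) (h : x ^ 2 ≤ P * Q) : x ≤ (θ * P + Q / θ) / 2 := by
  have hb : 0 ≤ (θ * P + Q / θ) / 2 := by positivity
  refine (pow_le_pow_iff_left₀ hx hb two_ne_zero).1 (h.trans ?_)
  have e : P * Q = (θ * P) * (Q / θ) := by field_simp
  rw [e]
  nlinarith [sq_nonneg (θ * P - Q / θ)]

/-- The kernel `y ↦ 2/((σ−α)((σ−α)²+y²))` times `|M_X(α+i(γ+y))|` is integrable, and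
`∫ 2/((σ−α)((σ−α)²+y²)) dy = 2π/(σ−α)²`. [folklore] -/
private theorem kernel_mul_mollifier_facts {σ α : ℝ} (hα0 : 0 ≤ α) (hσα : 0 < σ - α)
    (X : ℕ) (γ : ℝ) :
    Integrable (fun y : ℝ ↦ 2 / ((σ - α) * ((σ - α) ^ 2 + y ^ 2)) *
      ‖mollifier X ((α : ℂ) + (γ + y) * I)‖) ∧
    Integrable (fun y : ℝ ↦ 2 / ((σ - α) * ((σ - α) ^ 2 + y ^ 2))) ∧
    ∫ y : ℝ, 2 / ((σ - α) * ((σ - α) ^ 2 + y ^ 2)) = 2 * π / (σ - α) ^ 2 := by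
  have e : (fun y : ℝ ↦ 2 / ((σ - α) * ((σ - α) ^ 2 + y ^ 2))) =
      fun y : ℝ ↦ 2 / (σ - α) * ((σ - α) ^ 2 + y ^ 2)⁻¹ := by
    funext y
    have : (0 : ℝ) < (σ - α) ^ 2 + y ^ 2 := by positivity
    field_simp
  have hkfint : Integrable (fun y : ℝ ↦ 2 / ((σ - α) * ((σ - α) ^ 2 + y ^ 2))) := by
    rw [e]
    exact (Literature.NumberTheory.LFunctions.RieszPerron.integrable_inv_sq_add_sq hσα.ne').const_mul _
  have hmfc : Continuous fun y : ℝ ↦ ‖mollifier X ((α : ℂ) + (γ + y) * I)‖ := by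
    have : Continuous fun y : ℝ ↦ mollifier X ((α : ℂ) + (γ + y) * I) :=
      (differentiable_mollifier X).continuous.comp (by fun_prop)
    exact this.norm
  have hM_le : ∀ y : ℝ, ‖mollifier X ((α : ℂ) + (γ + y) * I)‖ ≤ max (X : ℝ) 0 := by
    intro y
    exact (norm_mollifier_le (X := X) (s := (α : ℂ) + (γ + y) * I) (by simp; exact hα0)).trans
      (le_max_left _ _)
  refine ⟨hkfint.mul_bdd hmfc.aestronglyMeasurable (Eventually.of_forall fun y ↦ by
      rw [Real.norm_of_nonneg (norm_nonneg _)]; exact hM_le y), hkfint, ?_⟩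
  rw [e, integral_const_mul, ZeroDensity.integral_inv_sq_add_sq_real hσα]
  field_simp

/-- **Class II counted** (Ivić (11.49)–(11.51) ⟹ (11.50):
`R₂ ≪ X^{2−2α} Y^{2α−2σ} M² log⁵ T` once `Y^{2σ−2α} ≫ M³ X^{1−α} log⁴ T`). Let `Z` be a `1`-spaced set
of points `ρ` (`σ ≤ Re ρ < 1`, `U < Im ρ ≤ 2U`, `2 ≤ U ≤ T`) each satisfying the Class-II inequality
`A ≤ ∫ |K(α−β+iy)| |ζ M_X|(α+i(γ+y)) dy` (`A = (5π/8)Y^{σ−α}` in the application); let `X ≤ 2^{J₂} ≤ 2X`,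
`J₂ ≥ 1`, `Γ = 2π/(σ−α)²`, `c_K = (128/(1−α)+256K)/π`, `c_T = (2/(1−α)+8K)/T`,
`a⋆ = 4(116 X^{2−2α} + 56 c_K X^{1−α})`, `b⋆ = 16(4M + c_T)X^{1−α}`. If the far tails are `≤ A/4` and
`MΓ + 2M²Γ²J₂² b⋆/A ≤ A/8` (Ivić's (11.51)), then `|Z| ≤ 4M²Γ²J₂² a⋆/A²` (Ivić's (11.50)). Proof: sum
`classTwo_reduce` over `Z` and exchange sum and integral — for EVERY shift `y` the points `γ_ρ + y` are
`1`-spaced, so `moebiusBlock_meanSquare` bounds `∑_ρ |block_j|²` uniformly in `y`; Cauchy–Schwarz in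
the AM–GM form `x ≤ (θR + (a⋆+Rb⋆)/θ)/2` with `θ = A/(4MΓJ₂)`, and absorption. (This replaces Ivić's
pointwise maximisation over `|v| ≤ log²T` and his `log⁴T`-separation, which the Riesz kernel's
`|y|⁻³` decay does not afford.) [cite: Ivic1985, §11.4 (11.49)–(11.51)] -/
theorem classTwo_count' {σ α M K T U A : ℝ} (hα : 1 / 2 ≤ α) (hασ : α < σ) (hσ1 : σ ≤ 1)
    (hT : 1 ≤ T) (hMpos : 0 < M) (hK0 : 0 ≤ K) (hU : 2 ≤ U) (hUT : U ≤ T)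
    (hM : ∀ t : ℝ, 1 ≤ |t| → |t| ≤ 3 * T → ‖riemannZeta ((α : ℂ) + t * I)‖ ≤ M)
    (hK : ∀ t : ℝ, ‖riemannZeta ((α : ℂ) + t * I)‖ ≤ 1 / (1 - α) + K * (1 + |t|))
    {X J₂ : ℕ} (hX : 1 ≤ X) (hJ₂ : X ≤ 2 ^ J₂) (hJ₂' : 2 ^ J₂ ≤ 2 * X) (hJ₂pos : 1 ≤ J₂)
    (hA0 : 0 < A)
    (Z : Finset ℂ) (hZ : ∀ ρ ∈ Z, σ ≤ ρ.re ∧ ρ.re < 1 ∧ U < ρ.im ∧ ρ.im ≤ 2 * U)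
    (hsep : ∀ ρ ∈ Z, ∀ ρ' ∈ Z, ρ ≠ ρ' → 1 ≤ |ρ.im - ρ'.im|)
    (hII : ∀ ρ ∈ Z, A ≤ ∫ y : ℝ, ‖rieszK (((α - ρ.re : ℝ) : ℂ) + y * I)‖ *
      (‖riemannZeta (α + (ρ.im + y) * I)‖ * ‖mollifier X (α + (ρ.im + y) * I)‖))
    (hfar : (1 + (X : ℝ) ^ (1 - α) / (1 - α)) * (π * (8 / (1 - α) + 48 * K) / U) ≤ A / 4)
    (hkill : M * (2 * π / (σ - α) ^ 2) + 2 * M ^ 2 * (2 * π / (σ - α) ^ 2) ^ 2 * (J₂ : ℝ) ^ 2 *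
      (16 * (4 * M + (2 / (1 - α) + 8 * K) / T) * (X : ℝ) ^ (1 - α)) / A ≤ A / 8) :
    (Z.card : ℝ) ≤ 4 * M ^ 2 * (2 * π / (σ - α) ^ 2) ^ 2 * (J₂ : ℝ) ^ 2 *
      (4 * (116 * (X : ℝ) ^ (2 - 2 * α) + 56 * ((128 / (1 - α) + 256 * K) / π) *
        (X : ℝ) ^ (1 - α))) / A ^ 2 := by
  classical
  have hα1 : α < 1 := by linarith
  have h1α : 0 < 1 - α := by linarith
  have hσα : 0 < σ - α := by linarith
  have hM0 : 0 ≤ M := hMpos.le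
  have hX0 : (0 : ℝ) < X := by exact_mod_cast hX
  have hU2T : U ≤ 2 * T := by linarith
  -- notation
  set R : ℝ := (Z.card : ℝ) with hR
  set Γ : ℝ := 2 * π / (σ - α) ^ 2 with hΓ
  have hΓ0 : 0 < Γ := by positivity
  set cK : ℝ := (128 / (1 - α) + 256 * K) / π with hcK
  have hcK0 : 0 ≤ cK := by positivity
  set cT : ℝ := (2 / (1 - α) + 8 * K) / T with hcT
  have hcT0 : 0 ≤ cT := by positivity
  set astar : ℝ := 4 * (116 * (X : ℝ) ^ (2 - 2 * α) + 56 * cK * (X : ℝ) ^ (1 - α)) with hastar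
  have hastar0 : 0 ≤ astar := by positivity
  set bstar : ℝ := 16 * (4 * M + cT) * (X : ℝ) ^ (1 - α) with hbstar
  have hbstar0 : 0 ≤ bstar := by positivity
  set far : ℝ := (1 + (X : ℝ) ^ (1 - α) / (1 - α)) * (π * (8 / (1 - α) + 48 * K) / U) with hfar_def
  set b : ℕ → ℂ := fun n ↦ if n ≤ X then ((ArithmeticFunction.moebius n : ℤ) : ℂ) else 0 with hb
  set kf : ℝ → ℝ := fun y ↦ 2 / ((σ - α) * ((σ - α) ^ 2 + y ^ 2)) with hkf
  have hkf0 : ∀ y, 0 ≤ kf y := fun y ↦ by positivity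
  set mf : ℂ → ℝ → ℝ := fun ρ y ↦ ‖mollifier X ((α : ℂ) + (ρ.im + y) * I)‖ with hmf
  set Bl : ℕ → ℂ → ℝ → ℝ := fun j ρ y ↦ ‖∑ n ∈ Finset.Ioc (2 ^ j) (2 * 2 ^ j),
    b n * (n : ℂ) ^ (-((α : ℂ) + (ρ.im + y) * I))‖ with hBl
  -- the trivial case
  rcases Nat.eq_zero_or_pos Z.card with hZ0 | hZpos
  · rw [hR, hZ0]; simp only [Nat.cast_zero]; positivity
  have hb1 : ∀ n, ‖b n‖ ≤ 1 := by
    intro n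
    simp only [hb]
    split_ifs
    · rw [Complex.norm_intCast]; exact_mod_cast ArithmeticFunction.abs_moebius_le_one
    · simp
  have hRpos : 0 < R := by rw [hR]; exact_mod_cast hZpos
  have hJr : (1 : ℝ) ≤ J₂ := by exact_mod_cast hJ₂pos
  set θ : ℝ := A / (4 * M * Γ * J₂) with hθ
  have hθ0 : 0 < θ := by positivity
  -- Step 1: per point
  have h1 : ∀ ρ ∈ Z, A - far ≤ M * ∫ y, kf y * mf ρ y := by
    intro ρ hρ
    obtain ⟨hb1, hb2, hg1, hg2⟩ := hZ ρ hρ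
    have h := classTwo_reduce hα hασ hM0 hK0 X hU hUT hM hK hb1 hb2 hg1 hg2 hA0 (hII ρ hρ)
    simp only [hkf, hmf]
    linarith
  -- Step 2: sum over `Z` and exchange
  have hint : ∀ ρ ∈ Z, Integrable fun y ↦ kf y * mf ρ y := fun ρ _ ↦
    (kernel_mul_mollifier_facts (by linarith) hσα X ρ.im).1
  obtain ⟨-, hkfint, hkfI⟩ := kernel_mul_mollifier_facts (by linarith : (0 : ℝ) ≤ α) hσα X 0
  have h2 : R * (A - far) ≤ M * ∫ y, kf y * ∑ ρ ∈ Z, mf ρ y := by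
    calc R * (A - far) = ∑ ρ ∈ Z, (A - far) := by rw [Finset.sum_const, nsmul_eq_mul]
      _ ≤ ∑ ρ ∈ Z, M * ∫ y, kf y * mf ρ y := Finset.sum_le_sum h1
      _ = M * ∑ ρ ∈ Z, ∫ y, kf y * mf ρ y := by rw [Finset.mul_sum]
      _ = M * ∫ y, ∑ ρ ∈ Z, kf y * mf ρ y := by rw [integral_finsetSum _ hint]
      _ = M * ∫ y, kf y * ∑ ρ ∈ Z, mf ρ y := by
          congr 1
          refine integral_congr_ae (Eventually.of_forall fun y ↦ ?_)
          show ∑ ρ ∈ Z, kf y * mf ρ y = kf y * ∑ ρ ∈ Z, mf ρ y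
          rw [Finset.mul_sum]
  -- Step 3: the pointwise bound, uniform in `y`
  set Fb : ℝ := R + J₂ * ((θ * R + (astar + R * bstar) / θ) / 2) with hFb
  have hFb0 : 0 ≤ Fb := by positivity
  have h3 : ∀ y : ℝ, ∑ ρ ∈ Z, mf ρ y ≤ Fb := by
    intro y
    -- mollifier ≤ 1 + ∑ blocks
    have hmol : ∀ ρ ∈ Z, mf ρ y ≤ 1 + ∑ j ∈ Finset.range J₂, Bl j ρ y := by
      intro ρ _
      have h := norm_mollifier_le_one_add_sum_blocks hX hJ₂ ((α : ℂ) + (ρ.im + y) * I)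
      simpa only [hmf, hBl, hb] using h
    -- each block: AM–GM from the mean square
    have hblock : ∀ j ∈ Finset.range J₂, ∑ ρ ∈ Z, Bl j ρ y ≤ (θ * R + (astar + R * bstar) / θ) / 2 := by
      intro j hj
      rw [Finset.mem_range] at hj
      set N : ℕ := 2 ^ j with hN
      have hN1 : 1 ≤ N := Nat.one_le_two_pow
      have hNX : N ≤ X := by
        have h1 : 2 ^ j ≤ 2 ^ (J₂ - 1) := Nat.pow_le_pow_right (by norm_num) (by omega)
        have h2 : 2 * 2 ^ (J₂ - 1) = 2 ^ J₂ := by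
          rw [← pow_succ']; congr 1; omega
        omega
      have hN0 : (0 : ℝ) < N := by exact_mod_cast hN1
      have hNXr : (N : ℝ) ≤ X := by exact_mod_cast hNX
      have h4N0 : (0 : ℝ) < ((4 * N : ℕ) : ℝ) := by push_cast; positivity
      have h4Nα : (((4 * N : ℕ) : ℝ)) ^ α ≤ 4 * (N : ℝ) ^ α := by
        push_cast
        rw [Real.mul_rpow (by norm_num) hN0.le]
        refine mul_le_mul_of_nonneg_right ?_ (Real.rpow_nonneg hN0.le _)
        calc (4 : ℝ) ^ α ≤ (4 : ℝ) ^ (1 : ℝ) :=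
              Real.rpow_le_rpow_of_exponent_le (by norm_num) hα1.le
          _ = 4 := Real.rpow_one _
      have hms := moebiusBlock_meanSquare hα hα1 hT hM0 hK0 hU2T hM hK b hb1 hN1 Z (U₁ := U)
        (fun ρ hρ ↦ ⟨(hZ ρ hρ).2.2.1.le, by linarith [(hZ ρ hρ).2.2.2]⟩) hsep y
      rw [← hcK, ← hcT] at hms
      -- the mean-square bound `≤ astar + R bstar`
      have hN2a : (N : ℝ) ^ α * (N : ℝ) ^ (1 - 2 * α) = (N : ℝ) ^ (1 - α) := by
        rw [← Real.rpow_add hN0]; congr 1; ring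
      have hN22 : (N : ℝ) * (N : ℝ) ^ (1 - 2 * α) = (N : ℝ) ^ (2 - 2 * α) := by
        rw [show (2 : ℝ) - 2 * α = 1 + (1 - 2 * α) by ring, Real.rpow_add hN0, Real.rpow_one]
      have hN1a : (N : ℝ) ^ (1 - α) ≤ (X : ℝ) ^ (1 - α) := Real.rpow_le_rpow hN0.le hNXr h1α.le
      have hN2b : (N : ℝ) ^ (2 - 2 * α) ≤ (X : ℝ) ^ (2 - 2 * α) :=
        Real.rpow_le_rpow hN0.le hNXr (by linarith)
      have hNpow0 : 0 ≤ (N : ℝ) ^ (1 - 2 * α) := Real.rpow_nonneg hN0.le _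
      have hsq : ∑ ρ ∈ Z, Bl j ρ y ^ 2 ≤ astar + R * bstar := by
        have eBl : ∑ ρ ∈ Z, Bl j ρ y ^ 2 =
            ∑ ρ ∈ Z, ‖∑ n ∈ Finset.Ioc N (2 * N), b n * (n : ℂ) ^ (-((α : ℂ) + (ρ.im + y) * I))‖ ^ 2 := by
          simp only [hBl, hN]
        rw [eBl]
        refine hms.trans ?_
        -- `4 (4N + 14Φ₂ + RΦ₁) N^{1−2α} ≤ astar + R bstar`
        have h4Nr : ((4 * N : ℕ) : ℝ) = 4 * (N : ℝ) := by push_cast; ring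
        have hΦ₂ : 14 * (2 * ((4 * N : ℕ) : ℝ) + (((4 * N : ℕ) : ℝ)) ^ α * cK) ≤
            112 * N + 56 * (N : ℝ) ^ α * cK := by
          have h1 := mul_le_mul_of_nonneg_right h4Nα hcK0
          rw [h4Nr] at h1 ⊢
          linarith
        have hMc : 0 ≤ 4 * M + cT := by positivity
        have hΦ₁ : (((4 * N : ℕ) : ℝ)) ^ α * (4 * M + cT) ≤ 4 * (N : ℝ) ^ α * (4 * M + cT) :=
          mul_le_mul_of_nonneg_right h4Nα hMc
        have hstep : 4 * (4 * N + 14 * (2 * ((4 * N : ℕ) : ℝ) + (((4 * N : ℕ) : ℝ)) ^ α * cK) +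
              R * ((((4 * N : ℕ) : ℝ)) ^ α * (4 * M + cT))) ≤
            4 * (4 * N + (112 * N + 56 * (N : ℝ) ^ α * cK) +
                R * (4 * (N : ℝ) ^ α * (4 * M + cT))) := by
          have := mul_le_mul_of_nonneg_left hΦ₁ hRpos.le
          linarith
        calc 4 * (4 * N + 14 * (2 * ((4 * N : ℕ) : ℝ) + (((4 * N : ℕ) : ℝ)) ^ α * cK) +
              R * ((((4 * N : ℕ) : ℝ)) ^ α * (4 * M + cT))) * (N : ℝ) ^ (1 - 2 * α)
            ≤ 4 * (4 * N + (112 * N + 56 * (N : ℝ) ^ α * cK) +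
                R * (4 * (N : ℝ) ^ α * (4 * M + cT))) * (N : ℝ) ^ (1 - 2 * α) :=
              mul_le_mul_of_nonneg_right hstep hNpow0
          _ = 4 * (116 * ((N : ℝ) * (N : ℝ) ^ (1 - 2 * α)) +
                56 * cK * ((N : ℝ) ^ α * (N : ℝ) ^ (1 - 2 * α))) +
              R * (16 * (4 * M + cT) * ((N : ℝ) ^ α * (N : ℝ) ^ (1 - 2 * α))) := by ring
          _ = 4 * (116 * (N : ℝ) ^ (2 - 2 * α) + 56 * cK * (N : ℝ) ^ (1 - α)) +
              R * (16 * (4 * M + cT) * (N : ℝ) ^ (1 - α)) := by rw [hN2a, hN22]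
          _ ≤ astar + R * bstar := by
              rw [hastar, hbstar]
              have e1 : 116 * (N : ℝ) ^ (2 - 2 * α) ≤ 116 * (X : ℝ) ^ (2 - 2 * α) :=
                mul_le_mul_of_nonneg_left hN2b (by norm_num)
              have e2 : 56 * cK * (N : ℝ) ^ (1 - α) ≤ 56 * cK * (X : ℝ) ^ (1 - α) :=
                mul_le_mul_of_nonneg_left hN1a (by positivity)
              have e3 : R * (16 * (4 * M + cT) * (N : ℝ) ^ (1 - α)) ≤
                  R * (16 * (4 * M + cT) * (X : ℝ) ^ (1 - α)) :=
                mul_le_mul_of_nonneg_left (mul_le_mul_of_nonneg_left hN1a (by positivity)) hRpos.le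
              linarith
      have hx0 : 0 ≤ ∑ ρ ∈ Z, Bl j ρ y := Finset.sum_nonneg fun ρ _ ↦ norm_nonneg _
      have hCS : (∑ ρ ∈ Z, Bl j ρ y) ^ 2 ≤ R * (astar + R * bstar) := by
        have h := sq_sum_le_card_mul_sum_sq (s := Z) (f := fun ρ ↦ Bl j ρ y)
        exact h.trans (mul_le_mul_of_nonneg_left hsq (Nat.cast_nonneg _))
      exact le_half_of_sq_le_mul hx0 hRpos.le (by positivity) hθ0 hCS
    calc ∑ ρ ∈ Z, mf ρ y ≤ ∑ ρ ∈ Z, (1 + ∑ j ∈ Finset.range J₂, Bl j ρ y) := Finset.sum_le_sum hmol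
      _ = R + ∑ j ∈ Finset.range J₂, ∑ ρ ∈ Z, Bl j ρ y := by
          rw [Finset.sum_add_distrib, Finset.sum_const, nsmul_eq_mul, mul_one, Finset.sum_comm]
      _ ≤ R + ∑ j ∈ Finset.range J₂, (θ * R + (astar + R * bstar) / θ) / 2 :=
          add_le_add le_rfl (Finset.sum_le_sum hblock)
      _ = Fb := by rw [hFb, Finset.sum_const, Finset.card_range, nsmul_eq_mul]
  -- Step 4: integrate
  have h4 : ∫ y, kf y * ∑ ρ ∈ Z, mf ρ y ≤ Γ * Fb := by
    have hg : Integrable fun y ↦ kf y * Fb := hkfint.mul_const Fb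
    calc ∫ y, kf y * ∑ ρ ∈ Z, mf ρ y ≤ ∫ y, kf y * Fb := by
          refine integral_mono_of_nonneg (Eventually.of_forall fun y ↦ ?_) hg
            (Eventually.of_forall fun y ↦ ?_)
          · exact mul_nonneg (hkf0 y) (Finset.sum_nonneg fun ρ _ ↦ norm_nonneg _)
          · exact mul_le_mul_of_nonneg_left (h3 y) (hkf0 y)
      _ = (∫ y, kf y) * Fb := integral_mul_const _ _
      _ = Γ * Fb := by rw [hkfI, hΓ]
  -- Step 5: algebra
  set Q₁ : ℝ := 2 * M ^ 2 * Γ ^ 2 * (J₂ : ℝ) ^ 2 * astar / A with hQ₁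
  set Q₂ : ℝ := 2 * M ^ 2 * Γ ^ 2 * (J₂ : ℝ) ^ 2 * bstar / A with hQ₂
  have hfar' : far ≤ A / 4 := hfar
  have hkill' : M * Γ + Q₂ ≤ A / 8 := hkill
  have h5 : R * (A - far) ≤ M * Γ * Fb := by
    calc R * (A - far) ≤ M * ∫ y, kf y * ∑ ρ ∈ Z, mf ρ y := h2
      _ ≤ M * (Γ * Fb) := mul_le_mul_of_nonneg_left h4 hM0
      _ = M * Γ * Fb := by ring
  have hMΓ0 : M * Γ * (J₂ : ℝ) ≠ 0 := by positivity
  have hθ1 : M * Γ * J₂ * θ = A / 4 := by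
    rw [hθ]; field_simp
  have hθ2 : M * Γ * J₂ / θ = 4 * M ^ 2 * Γ ^ 2 * (J₂ : ℝ) ^ 2 / A := by
    rw [hθ]; field_simp
  have hMΓFb : M * Γ * Fb = M * Γ * R + A / 8 * R + Q₁ + R * Q₂ := by
    have e1 : M * Γ * Fb = M * Γ * R + (M * Γ * J₂ * θ) * R / 2 +
        (M * Γ * J₂ / θ) * (astar + R * bstar) / 2 := by
      rw [hFb]; ring
    rw [e1, hθ1, hθ2, hQ₁, hQ₂]
    ring
  have h6 : R * A / 2 ≤ Q₁ := by
    have e1 : R * A - R * (A / 4) ≤ R * (A - far) := by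
      have := mul_le_mul_of_nonneg_left hfar' hRpos.le
      rw [mul_sub]; linarith
    have e2 : R * (M * Γ) + R * Q₂ ≤ R * (A / 8) := by
      have := mul_le_mul_of_nonneg_left hkill' hRpos.le
      rw [mul_add] at this; exact this
    rw [hMΓFb] at h5
    linarith
  have hA2 : 0 < A ^ 2 := by positivity
  rw [le_div_iff₀ hA2]
  have e : Q₁ * (2 * A) = 4 * M ^ 2 * Γ ^ 2 * (J₂ : ℝ) ^ 2 * astar := by
    rw [hQ₁]; field_simp; ring
  have h7 := mul_le_mul_of_nonneg_right h6 (by positivity : (0 : ℝ) ≤ 2 * A)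
  rw [e] at h7
  have e' : R * A / 2 * (2 * A) = R * A ^ 2 := by ring
  linarith

/-! ## Part E. The count of a `1`-spaced set of zeros in one dyadic height block -/

/-- **Per-block count** (Ivić (11.12) with (11.47) and (11.50): every representative zero is of
Class I or Class II, `NearOneDetect.perZero_dichotomy_line`; Class I counted by
`classOne_count'`, Class II by `classTwo_count'`). All size conditions are hypotheses here; they are
verified for the parameter choice (11.48)/(11.51) in Part F. [cite: Ivic1985, §11.2 (11.12),
§11.4 (11.47), (11.50)] -/
theorem perBlock_count {σ α M K T U : ℝ} {X Y J J₂ : ℕ} (hα : 1 / 2 ≤ α) (hασ : α < σ)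
    (hσ1 : σ ≤ 1) (he : α + 1 - 2 * σ ≤ 0) (hT : 1 ≤ T) (hMpos : 0 < M) (hK0 : 0 ≤ K)
    (hM : ∀ t : ℝ, 1 ≤ |t| → |t| ≤ 3 * T → ‖riemannZeta ((α : ℂ) + t * I)‖ ≤ M)
    (hK : ∀ α' t : ℝ, 1 / 2 ≤ α' → α' < 1 →
      ‖riemannZeta ((α' : ℂ) + t * I)‖ ≤ 1 / (1 - α') + K * (1 + |t|))
    (hX : 1 ≤ X) (hY4 : 4 ≤ Y) (hJ : Y ≤ X * 2 ^ J) (hJ' : ∀ i < J, X * 2 ^ i < Y)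
    (hJ₂ : X ≤ 2 ^ J₂) (hJ₂' : 2 ^ J₂ ≤ 2 * X) (hJ₂pos : 1 ≤ J₂)
    (hU : 2 ≤ U) (hUT : U ≤ T)
    (hres : 2 * (Y : ℝ) ^ (1 - σ) * (1 + Real.log X) / U ^ 3 ≤ 1 / 8)
    (hX5 : (128 / (1 - α) + 256 * K) / π ≤ (X : ℝ) ^ (1 - α))
    (hTM : (2 / (1 - α) + 8 * K) / T ≤ M)
    (habs : 18 * (64 * (J : ℝ) ^ 2) * (40 * M *
      (X : ℝ) ^ (α + 1 - 2 * σ) * (1 + Real.log (2 * Y)) ^ 3) ≤ 1)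
    (hfar : (1 + (X : ℝ) ^ (1 - α) / (1 - α)) * (π * (8 / (1 - α) + 48 * K) / U) ≤
      5 * π / 8 * (Y : ℝ) ^ (σ - α) / 4)
    (hkill : M * (2 * π / (σ - α) ^ 2) + 2 * M ^ 2 * (2 * π / (σ - α) ^ 2) ^ 2 * (J₂ : ℝ) ^ 2 *
      (16 * (4 * M + (2 / (1 - α) + 8 * K) / T) * (X : ℝ) ^ (1 - α)) /
        (5 * π / 8 * (Y : ℝ) ^ (σ - α)) ≤ 5 * π / 8 * (Y : ℝ) ^ (σ - α) / 8)
    (Z : Finset ℂ) (hZ : ∀ ρ ∈ Z, riemannZeta ρ = 0 ∧ σ ≤ ρ.re ∧ U < ρ.im ∧ ρ.im ≤ 2 * U)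
    (hsep : ∀ ρ ∈ Z, ∀ ρ' ∈ Z, ρ ≠ ρ' → 1 ≤ |ρ.im - ρ'.im|) :
    (Z.card : ℝ) ≤ 396288 * (J : ℝ) ^ 3 * (Y : ℝ) ^ (2 - 2 * σ) * (1 + Real.log (2 * Y)) ^ 3 +
      4 * M ^ 2 * (2 * π / (σ - α) ^ 2) ^ 2 * (J₂ : ℝ) ^ 2 *
        (4 * (116 * (X : ℝ) ^ (2 - 2 * α) + 56 * ((128 / (1 - α) + 256 * K) / π) *
          (X : ℝ) ^ (1 - α))) / (5 * π / 8 * (Y : ℝ) ^ (σ - α)) ^ 2 := by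
  classical
  have hα1 : α < 1 := by linarith
  have hU1 : 1 ≤ U := by linarith
  have hU2T : U ≤ 2 * T := by linarith
  have hY1 : 1 ≤ Y := by omega
  have hY0 : (0 : ℝ) < Y := by exact_mod_cast (by omega : 0 < Y)
  have hKα : ∀ t : ℝ, ‖riemannZeta ((α : ℂ) + t * I)‖ ≤ 1 / (1 - α) + K * (1 + |t|) :=
    fun t ↦ hK α t hα hα1
  set A : ℝ := 5 * π / 8 * (Y : ℝ) ^ (σ - α) with hA
  have hA0 : 0 < A := by positivity
  -- the Class-I / Class-II split
  set P : ℂ → Prop := fun ρ ↦ 1 / 8 ≤ ‖∑ n ∈ Finset.Ioc X (X * 2 ^ J),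
    ZeroDensity.coeffB X Y n * (n : ℂ) ^ (-ρ)‖ with hP
  set ZI := Z.filter P with hZI
  set ZII := Z.filter (fun ρ ↦ ¬ P ρ) with hZII
  have hcard : (Z.card : ℝ) = ZI.card + ZII.card := by
    rw [hZI, hZII]
    exact_mod_cast (Finset.card_filter_add_card_filter_not P).symm
  have hre1 : ∀ ρ ∈ Z, ρ.re < 1 := by
    intro ρ hρ
    by_contra h
    exact riemannZeta_ne_zero_of_one_le_re (not_lt.1 h) (hZ ρ hρ).1
  -- Class I
  have hI : (ZI.card : ℝ) ≤ 396288 * (J : ℝ) ^ 3 * (Y : ℝ) ^ (2 - 2 * σ) *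
      (1 + Real.log (2 * Y)) ^ 3 := by
    refine classOne_count' hα hα1 hσ1 he hT hX hY1 hJ' hU2T hMpos.le hK0 hM hKα hX5 hTM habs
      ZI ?_ ?_ ?_
    · intro ρ hρ
      have hρZ := (Finset.mem_filter.1 hρ).1
      obtain ⟨-, hb, hg1, hg2⟩ := hZ ρ hρZ
      exact ⟨hb, hre1 ρ hρZ, hg1, hg2⟩
    · exact fun ρ hρ ρ' hρ' hne ↦ hsep ρ (Finset.mem_filter.1 hρ).1 ρ' (Finset.mem_filter.1 hρ').1 hne
    · intro ρ hρ
      exact (Finset.mem_filter.1 hρ).2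
  -- Class II
  have hII : (ZII.card : ℝ) ≤ 4 * M ^ 2 * (2 * π / (σ - α) ^ 2) ^ 2 * (J₂ : ℝ) ^ 2 *
      (4 * (116 * (X : ℝ) ^ (2 - 2 * α) + 56 * ((128 / (1 - α) + 256 * K) / π) *
        (X : ℝ) ^ (1 - α))) / A ^ 2 := by
    refine classTwo_count' hα hασ hσ1 hT hMpos hK0 hU hUT hM hKα hX hJ₂ hJ₂' hJ₂pos hA0 ZII
      ?_ ?_ ?_ hfar hkill
    · intro ρ hρ
      have hρZ := (Finset.mem_filter.1 hρ).1
      obtain ⟨-, hb, hg1, hg2⟩ := hZ ρ hρZ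
      exact ⟨hb, hre1 ρ hρZ, hg1, hg2⟩
    · exact fun ρ hρ ρ' hρ' hne ↦ hsep ρ (Finset.mem_filter.1 hρ).1 ρ' (Finset.mem_filter.1 hρ').1 hne
    · intro ρ hρ
      obtain ⟨hρZ, hnot⟩ := Finset.mem_filter.1 hρ
      obtain ⟨hζ, hb, hg1, -⟩ := hZ ρ hρZ
      rcases perZero_dichotomy_line hα hασ hX hY4 hJ hU1 hres hζ hb hg1 with h | h
      · exact absurd h hnot
      · exact h
  rw [hcard]
  exact add_le_add hI hII

/-! ## Part F. Auxiliary facts for the assembly -/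

/-- **A positive lower bound for `ζ` on the segment `{α + i : 1/2 ≤ α ≤ 1}`**: `ζ(α + i) ≠ 0`
there (no zero of `ζ` has `0 < Im ρ ≤ 14`, `riemannZeta_ne_zero_of_im_pos_of_im_le_fourteen`, a
kernel-checked Backlund certificate), and a continuous non-vanishing function on a compact set is
bounded below. This is what makes Ivić's `M(α, 3T) ≥ |ζ(α + i)|` bounded away from `0`, so that
additive `O(1)` terms are `O(M)`. [cite: Edwards1974, §6.6] -/
theorem exists_norm_zeta_line_ge :
    ∃ m₀ : ℝ, 0 < m₀ ∧ ∀ α : ℝ, 1 / 2 ≤ α → α ≤ 1 → m₀ ≤ ‖riemannZeta ((α : ℂ) + I)‖ := by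
  have hc : IsCompact (Set.Icc (1 / 2 : ℝ) 1) := isCompact_Icc
  have hne : (Set.Icc (1 / 2 : ℝ) 1).Nonempty := ⟨1, by norm_num⟩
  have hcont : ContinuousOn (fun α : ℝ ↦ ‖riemannZeta ((α : ℂ) + I)‖) (Set.Icc (1 / 2 : ℝ) 1) := by
    refine ContinuousOn.norm (fun α hα ↦ ?_)
    have h1 : ((α : ℂ) + I) ≠ 1 := fun h ↦ by
      have := congrArg Complex.im h; simp at this
    have hg : Continuous fun α : ℝ ↦ (α : ℂ) + I := by fun_prop
    exact (ContinuousAt.comp (g := riemannZeta) (f := fun α : ℝ ↦ (α : ℂ) + I)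
      (differentiableAt_riemannZeta h1).continuousAt hg.continuousAt).continuousWithinAt
  obtain ⟨α₀, hα₀, hmin⟩ := hc.exists_isMinOn hne hcont
  refine ⟨‖riemannZeta ((α₀ : ℂ) + I)‖, ?_, fun α h1 h2 ↦ hmin ⟨h1, h2⟩⟩
  have hne0 : riemannZeta ((α₀ : ℂ) + I) ≠ 0 :=
    riemannZeta_ne_zero_of_im_pos_of_im_le_fourteen (by simp) (by simp)
  exact norm_pos_iff.2 hne0

/-- `ζ` is bounded on `1/2 ≤ Re s ≤ 1`, `1 ≤ Im s ≤ 3` (continuity away from the pole), with a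
bound `K₀ ≥ 1` (the private lemma of `ZeroDensityNearOne.lean`, re-derived). [folklore] -/
private theorem exists_norm_zeta_le_small_height' :
    ∃ K : ℝ, 1 ≤ K ∧ ∀ α t : ℝ, 1 / 2 ≤ α → α ≤ 1 → 1 ≤ t → t ≤ 3 →
      ‖riemannZeta (α + t * I)‖ ≤ K := by
  have hc : IsCompact (Set.Icc (1 / 2 : ℝ) 1 ×ℂ Set.Icc (1 : ℝ) 3) :=
    isCompact_Icc.reProdIm isCompact_Icc
  have hcont : ContinuousOn riemannZeta (Set.Icc (1 / 2 : ℝ) 1 ×ℂ Set.Icc (1 : ℝ) 3) := by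
    intro s hs
    refine (differentiableAt_riemannZeta ?_).continuousAt.continuousWithinAt
    rintro rfl
    rw [Complex.mem_reProdIm] at hs
    have := hs.2.1
    norm_num at this
  obtain ⟨K, hK⟩ := hc.exists_bound_of_continuousOn hcont
  refine ⟨max K 1, le_max_right _ _, fun α t h1 h2 h3 h4 ↦ (hK _ ?_).trans (le_max_left _ _)⟩
  have hre : ((α : ℂ) + t * I).re = α := by simp
  have him : ((α : ℂ) + t * I).im = t := by simp
  rw [Complex.mem_reProdIm, hre, him]
  exact ⟨⟨h1, h2⟩, ⟨h3, h4⟩⟩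

/-- **The log-power slack**: for every `c` there is `L₀ ≥ 1` with `c·L·(1 + log L) ≤ L^{5/4}` for
`L ≥ L₀` (`log L = o(L^{1/4})`). [folklore] -/
private theorem exists_mul_log_le_rpow (c : ℝ) :
    ∃ L₀ : ℝ, 1 ≤ L₀ ∧ ∀ L : ℝ, L₀ ≤ L → c * L * (1 + Real.log L) ≤ L ^ (5 / 4 : ℝ) := by
  rcases le_or_gt c 0 with hc | hc
  · refine ⟨1, le_rfl, fun L hL ↦ ?_⟩
    have h1 : 0 ≤ 1 + Real.log L := by have := Real.log_nonneg hL; linarith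
    have h2 : c * L * (1 + Real.log L) ≤ 0 := by
      have : c * L ≤ 0 := mul_nonpos_of_nonpos_of_nonneg hc (by linarith)
      exact mul_nonpos_of_nonpos_of_nonneg this h1
    exact h2.trans (Real.rpow_nonneg (by linarith) _)
  · have ho := (isLittleO_log_rpow_atTop (by norm_num : (0 : ℝ) < 1 / 4)).def
      (by positivity : (0 : ℝ) < 1 / (2 * c))
    have hev : ∀ᶠ L : ℝ in atTop, (2 * c) ^ (4 : ℕ) ≤ L := Filter.eventually_ge_atTop _
    obtain ⟨L₁, hL₁⟩ := Filter.eventually_atTop.1 (ho.and hev)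
    refine ⟨max L₁ 1, le_max_right _ _, fun L hL ↦ ?_⟩
    have hL1 : 1 ≤ L := (le_max_right _ _).trans hL
    have hL0 : 0 < L := by linarith
    obtain ⟨h1, h2⟩ := hL₁ L ((le_max_left _ _).trans hL)
    rw [Real.norm_of_nonneg (Real.log_nonneg hL1), Real.norm_of_nonneg (Real.rpow_nonneg hL0.le _)]
      at h1
    -- `2c ≤ L^{1/4}`
    have h3 : 2 * c ≤ L ^ (1 / 4 : ℝ) := by
      have h4 : ((2 * c) ^ (4 : ℕ) : ℝ) ^ (1 / 4 : ℝ) ≤ L ^ (1 / 4 : ℝ) :=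
        Real.rpow_le_rpow (by positivity) h2 (by norm_num)
      rw [← Real.rpow_natCast, ← Real.rpow_mul (by positivity)] at h4
      norm_num at h4
      exact h4
    have h5 : c * (1 + Real.log L) ≤ L ^ (1 / 4 : ℝ) := by
      have h6 : c * Real.log L ≤ L ^ (1 / 4 : ℝ) / 2 := by
        have := mul_le_mul_of_nonneg_left h1 hc.le
        have e : c * (1 / (2 * c) * L ^ (1 / 4 : ℝ)) = L ^ (1 / 4 : ℝ) / 2 := by field_simp
        linarith [e.le, e.ge]
      linarith
    calc c * L * (1 + Real.log L) = L * (c * (1 + Real.log L)) := by ring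
      _ ≤ L * L ^ (1 / 4 : ℝ) := mul_le_mul_of_nonneg_left h5 hL0.le
      _ = L ^ (5 / 4 : ℝ) := by
          rw [show (5 / 4 : ℝ) = 1 + 1 / 4 by norm_num, Real.rpow_add hL0, Real.rpow_one]

/-- Ceiling facts: for `x ≥ 1`, `⌈x⌉₊ ≥ 1`, `x ≤ ⌈x⌉₊ ≤ 2x`. [folklore] -/
private theorem natCeil_facts' {x : ℝ} (hx : 1 ≤ x) :
    1 ≤ ⌈x⌉₊ ∧ x ≤ (⌈x⌉₊ : ℝ) ∧ (⌈x⌉₊ : ℝ) ≤ 2 * x := by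
  refine ⟨Nat.one_le_iff_ne_zero.2 (by rw [Ne, Nat.ceil_eq_zero]; linarith), Nat.le_ceil x, ?_⟩
  have := Nat.ceil_lt_add_one (by linarith : 0 ≤ x)
  linarith

/-- `x ≤ X ≤ c x` with `x ≥ 1 ≥ 0`, `c ≥ 1`, `0 ≤ e ≤ 1` ⇒ `x^e ≤ X^e ≤ c x^e`. [folklore] -/
private theorem rpow_between {x X c e : ℝ} (hx : 1 ≤ x) (h1 : x ≤ X) (h2 : X ≤ c * x) (hc : 1 ≤ c)
    (he0 : 0 ≤ e) (he1 : e ≤ 1) : x ^ e ≤ X ^ e ∧ X ^ e ≤ c * x ^ e := by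
  have hx0 : 0 ≤ x := by linarith
  refine ⟨Real.rpow_le_rpow hx0 h1 he0, ?_⟩
  calc X ^ e ≤ (c * x) ^ e := Real.rpow_le_rpow (by linarith) h2 he0
    _ = c ^ e * x ^ e := Real.mul_rpow (by linarith) hx0
    _ ≤ c * x ^ e := by
        refine mul_le_mul_of_nonneg_right ?_ (Real.rpow_nonneg hx0 _)
        calc c ^ e ≤ c ^ (1 : ℝ) := Real.rpow_le_rpow_of_exponent_le hc he1
          _ = c := Real.rpow_one c

/-- **The corner `σ ≥ 1 − 1/(R log T)`: no zeros at all** (Ivić: "we may suppose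
`σ < 1 − C/log T` in view of the zero-free region (1.55)"; here the tree's classical region
`HasClassicalZeroFreeRegion R` and `N(14) = 0`). [cite: Ivic1985, §11.4, proof of Theorem 11.3,
p. 280] [cite: MontgomeryVaughan2007, Theorem 6.6] -/
theorem zetaZeroCountRe_eq_zero_of_zeroFree {R σ T : ℝ} (hR : 0 < R)
    (hZ : HasClassicalZeroFreeRegion R)
    (hσ : 1 - 1 / (R * Real.log T) ≤ σ) : zetaZeroCountRe σ T = 0 := by
  have hempty : zetaZeroBox σ T = ∅ := by
    ext ρ
    simp only [zetaZeroBox, Set.mem_setOf_eq, Set.mem_empty_iff_false, iff_false, not_and]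
    intro hζ hre _ him hT'
    -- `Im ρ > 14`
    have h14 : 14 < ρ.im := by
      by_contra h
      exact riemannZeta_ne_zero_of_im_pos_of_im_le_fourteen him (not_lt.1 h) hζ
    have h2 : 2 ≤ |ρ.im| := by rw [abs_of_pos him]; linarith
    have hlog : Real.log |ρ.im| ≤ Real.log T := by
      rw [abs_of_pos him]; exact Real.log_le_log him hT'
    have hlog0 : 0 < Real.log |ρ.im| := Real.log_pos (by linarith)
    have hσ' : 1 - 1 / (R * Real.log |ρ.im|) ≤ ρ.re := by
      have h1 : 1 / (R * Real.log T) ≤ 1 / (R * Real.log |ρ.im|) :=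
        one_div_le_one_div_of_le (by positivity) (by nlinarith)
      linarith
    have := hZ ρ.re ρ.im h2 hσ'
    rw [show ((ρ.re : ℂ) + (ρ.im : ℂ) * I) = ρ from Complex.re_add_im ρ] at this
    exact this hζ
  rw [zetaZeroCountRe, hempty]
  simp

end IvicNearOne

end Literature.NumberTheory.LFunctions

end
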